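import Mathlib
import HarnessLib
import HarnessLib.Audit
import Summits.Langlands.Statement
import Literature.NumberTheory.Automorphic.GLnAdelicStructureProofs
import Literature.NumberTheory.GaloisRepresentations.LocalGaloisGroupProofs
import Literature.NumberTheory.GaloisRepresentations.LocalGaloisGroupFrobeniusProofs
import Literature.NumberTheory.Automorphic.LocalConstantsProofs
import Literature.NumberTheory.Automorphic.LocalLanglandsGLProofs
import HarnessLib.Audit.Status.Attr

/-!
Route: HolomorphicShadow

# Route HolomorphicShadow — even strong Artin as modularity of holomorphic shadows in regular
weight, read back by Berezin symbol recovery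

X = ShadowModularity ∧ ShadowConverse ("it suffices to show"; card
Langlands/Langlands/holomorphic-shadow-converse). For an irreducible EVEN Artin ρ : Γ_ℚ → GL₂(ℂ)
take ARTIN DATA (N, χ, ε, a): a modulus N > 0 divisible by every ramified prime, the Dirichlet
character χ mod N with χ(p) = det ρ(Frob_p) (arithmetic Frobenius), the parity ε = ±1 (ρ(c) = ε·1)
and a = (a_n) the Dirichlet coefficients of the PARTIAL Artin L-function L^N(s,ρ) = Π_(p∤N) det(1 −
ρ(Frob_p) p^(−s))^(−1), pinned WITHOUT any L-function: a₁ = 1, a multiplicative, a(p^(j+1)) = 0 for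
p ∣ N, and for p ∤ N the Frobenius recursion a(p^(j+2)) = a_p a(p^(j+1)) − χ(p) a(p^j) with charpoly
ρ(Frob_p) = X² − a_p X + χ(p) (ρ unramified at p). Put φ_a(z) = Σ_(n≥1) a_n √y K₀(2πny)(e(nx) + ε
e(−nx)) — the weight-0, eigenvalue-1/4 Maass form that (B) predicts (with its Euler factors at p ∣ N
removed) and no cohomology sees. For a holomorphic cusp form g = Σ b_m q^m ∈ S_k(Γ₀(L), ψ) the
HOLOMORPHIC SHADOW H_(a,g) = Σ c_m q^m is the explicit, absolutely convergent shifted convolution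
c_m = (4πm)^(k−1)/Γ(k−1) · Σ_(m'≠m) sgn_ε(m−m') a_|m−m'| b_m' ∫_0^∞ y^(k−3/2) K₀(2π|m−m'|y)
e^(−2π(m+m')y) dy (Sturm's projection formula applied FORMALLY to φ_a·g). ShadowModularity (the
bet): for every such datum there is a level L₀ (N ∣ L₀) such that every shadow against every
S_k(Γ₀(L), ψ), L₀ ∣ L, k ≥ 4, lies in S_k(Γ₀(L), χψ). ShadowConverse (new theorem): if all shadows
of a polynomially bounded sequence a against S_k(Γ₀(L), ψ), k ≥ k₀, are cusp forms of character χψ,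
then φ_a(γz) = χ(d_γ) φ_a(z) on Γ₀(L). Together with the Maass-eigenform dictionary they give the
target EvenStrongArtinSC (even strong Artin over ℚ, definitionally the target stmt-Langlands-3310 of
route EvenArtinQuantumBoundary with `FramedArtinRep ℚ 2` unfolded to `FramedGaloisRep ℚ ℂ 2`), i.e.
the even, Hodge–Tate (0,0) slice of conjunct (B) for n = 2 over ℚ; the JUNCTION CRUX
SectorComplement (rank 5, owned by this route; rev 8 stated over the OUTPUT of X) — `Langlands`
GIVEN the Maass automorphy of every admissible Artin datum: for every irreducible σ and every (N, χ,
ε, a) as above with ‖a_n‖ ≤ C(n+1)^A there is a level L > 0, N ∣ L, with φ_(a,ε)(γz) = χ(d_γ)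
φ_(a,ε)(z) on Γ₀(L) — carries X to `Langlands`, so the route encompasses the entire summit and its
deciding theorem is crux-only: `closes : ShadowModularity → ShadowConverse → SectorComplement →
Langlands`, three crux hypotheses and nothing else; the two dictionaries (MaassEigenformStrongArtin,
EvenArtinShadowData) stay as supports that turn X into the target EvenStrongArtinSC by name (item
EvenArtinFromShadows).
Lean: `ShadowModularity ∧ ShadowConverse`

TYPING (route-repair 2026-08-15, cone guardrail; gen 1 unit
rrepair-Langlands-HolomorphicShadow-1d21ff1a, gen 2 unit
rrepair-Langlands-HolomorphicShadow-1d21ff1a-g2). Every item is typed over the cone of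
`Summits.Langlands.Statement` (Sketch/Diag `lean check` rc 0; `closes` sorry-free, axioms
propext/Classical.choice/Quot.sound). Gen 1 (rev 1–3): rev 0's imports
GaloisRepresentations.ArtinLFunction + Automorphic.AutomorphicRepsGL dragged
ArtinLFunction/ArtinConductor/RamificationFiltration and 14 unproved named facts (largest
GaloisRep.natCast_localArtinConductor) into the module cone although no item used them; the Artin
vocabulary was unfolded — `FramedArtinRep ℚ 2` = `FramedGaloisRep ℚ ℂ 2` (abbrev, definitional),
`LSeries a = artinLFunction σ` replaced by the EULER PINNING of a to σ at the primes p ∤ N through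
FramedGaloisRep.IsUnramifiedAt / HasFrobCharpolyAt v (X² − C a_p·X + C χ(p)) plus multiplicativity
and the degree-2 recursion (= coefficients of the partial L-function, a₁ = 1, |a_n| ≤ d(n)), `N =
artinConductorNat σ` replaced by an existential level (ShadowModularity concludes ∃ L₀, N ∣ L₀;
MaassEigenformStrongArtin and ShadowConverse were level-agnostic already); the shared items
EvenStrongArtin (stmt-Langlands-3310) / OffEvenArtin (stmt-Langlands-3317) mention FramedArtinRep
and stay with route EvenArtinQuantumBoundary, this route wants their definitional twins
EvenStrongArtinSC / OffEvenArtinSC (the latter re-filed at rev 5 as the junction crux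
SectorComplement, restated at rev 8 over the output of X). Gen 2 (rev 4): the 12 unproved named
facts still counted are those of the import cone of `Summits.Langlands.Langlands.Statement` ITSELF
(59 project modules, shared by every route of the summit — cf. E8QuinticResidue,
EisensteinMonodromy, WeightVelocityMonodromy); no import of this file can remove them. Declaration
cone of the items + `closes` (`#h21_route_deps`, reproduced in the seat's Diag.lean): 309 project
constants, 85 Prop definitions; closed facts (0 explicit binders) without a `_holds` witness
reachable DIRECTLY from the items: none; reachable only through the summit statement:
isOpen_ker_quasiChar, exists_isFrobPow, IsFrobPow.mul, IsFrobPow.unique,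
WeilGroup.exists_subgroup_le_inertia_isOpen_of_continuous — all five PROVED in the tree, as is the
one direct dependency with binders, isCompact_glFiniteIntegralLevel
(isCompact_glFiniteIntegralLevel_holds, GLnAdelicStructureProofs). Rev 4 therefore ADDS the five
witness-carrying modules Automorphic.GLnAdelicStructureProofs,
GaloisRepresentations.LocalGaloisGroupProofs, GaloisRepresentations.LocalGaloisGroupFrobeniusProofs,
Automorphic.LocalConstantsProofs, Automorphic.LocalLanglandsGLProofs to the route imports (audit:
unproved closed deps 5 → 0; module cone 59 → 68 modules with NO new unproved fact, checked in the
seat's ConeC.lean; the same Proofs imports ride on CMFern / LiftDescend / BaseFieldAscent). Fact map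
per item, at proof level: ShadowModularity, ShadowConverse, DeltaTowerConverse, ShadowNecessity,
BerezinLocalization — Mathlib analysis only, no cone fact; EvenArtinShadowData — proved tree
theorems only (ArtinRep.finite_range_holds, ArtinRep.isUnramifiedAE, KroneckerWeber_holds,
exists_dirichletCharacter_of_kroneckerWeber, hasFrobCharpolyAt_frobCharpoly_holds);
MaassEigenformStrongArtin — the GL_n automorphic-forms dictionary, whose named facts are now
discharged (isCompact_glFiniteIntegralLevel_holds, automorphicForms_isStableSubmodule_holds,
AutomorphicRepsGL.exists_cuspidalRepData_of_L2_holds, AutomorphicRepsGL.exists_isAssociatedL2_holds,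
heckePolynomial_eq_satakePolynomial_holds; hasSatakeParamAt_iff_L2 has no witness yet and is
avoidable by building the RepData as the stable span of the adelic lift), plus the
classical-Maass-form → adelic lift, which is Lean work (IsMaassCuspForm exists for SL₂(ℤ)/Fuchsian
groups only), not a named fact; SectorComplement (junction crux, formerly OffEvenArtinSC; rev 8: `(∀
σ irreducible, ∀ admissible (N, χ, ε, a) with polynomial growth, ∃ L > 0, N ∣ L, φ_(a,ε)
Γ₀(L)-automorphic with character χ) → _root_.Langlands`, its `let` gadgets K0 / maass / EulerPin /
ParityPin byte-identical with the other items; Sketch.lean rc 0 for `closes`,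
`evenArtinFromShadows_holds`, `sectorComplement_of_old : (EvenStrongArtinSC → Langlands) →
MaassEigenformStrongArtin → EvenArtinShadowData → SectorComplement` and
`sectorComplement_of_langlands : Langlands → SectorComplement`, same three axioms) — reciprocity for
GL_n outside the even-Artin slice plus the classical Maass-eigenform → automorphic-representation
dictionary of the slice, whose cone is the summit statement's own, including the shared Statement
debt LocalLanglandsDatum.nonempty / PstWeilDeligneData.nonempty (declared needs-fact by
WeightVelocityMonodromy, TriangulineChamber, WachCensus). needs-fact: none. ROUTE-CHOICE
(2026-08-16; units rchoice-Langlands-HolomorphicShadow-pa-37d1e7cd gen 1 = rev 5/6, gen 3 = rev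
8/9): option (a) — the complementary sector is a ranked crux the route OWNS (SectorComplement, rank
5, kind crux since the AUTO-CRUX sweep of 02:19Z, own why-it-might-fail and sources); rev 8 restates
it over the output of X so that the deciding theorem assumes the three cruxes ShadowModularity,
ShadowConverse, SectorComplement and nothing else (crux-only deciding theorem, 2026-08-16: supports
are proved lemmas, never hypotheses of `closes`); option (b), closing with a banked result, was
declined: no item of the route is proved yet and its informative cruxes #2/#3 are live and vetted.

## Assembly
Pure logic (sorry-free `closes` in glue.lean, elaborated in Sketch.lean, rev 8): `closes hSM hSC hC
:= hC (…)`, where the antecedent of SectorComplement is discharged as follows — fix σ irreducible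
and an admissible datum (N, χ, ε, a) with its parity pin, Euler pin and polynomial bound;
ShadowModularity gives a level L₀ > 0 with N ∣ L₀ at which all shadows (k ≥ 4, ψ = 1) are cusp forms
of character χ; that is exactly the hypothesis of ShadowConverse at (N, L₀, χ, ψ = 1, k₀ = 4), which
returns Γ₀(L₀)-automorphy of φ_(a,ε) with character χ; SectorComplement then yields `Langlands`. Off
the deciding path: the target chain EvenArtinFromShadows : ShadowModularity → ShadowConverse →
MaassEigenformStrongArtin → EvenArtinShadowData → EvenStrongArtinSC (support, provable now — it is
the rev-6 `closes` body: Artin data from EvenArtinShadowData, the same two steps, then the Maass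
dictionary produces the cuspidal P matching σ a.e.), and DeltaTowerConverse, ShadowNecessity,
BerezinLocalization (sharpening, negative side, layer-2 lemma). The item `Assembly` is the same
implication as a Prop — ShadowModularity → ShadowConverse → SectorComplement → Langlands, restated
at rev 9 to match the crux-only `closes` (`assembly_holds := closes` in Sketch.lean) — and is not a
hypothesis of `closes`.

Rationale: WHY THIS LINE. The singular parameter (weight 0, λ = 1/4) has no algebraic model, and every
tensorial operation keeps a repeated Hodge–Tate weight repeated (NonRegularWeightBarrier); pointwise
multiplication by a holomorphic cusp form g is the one natural non-tensorial operation, and Sturm's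
holomorphic projection (Sturm1980; GrossZagier1986 §IV.5) is its exact bookkeeping: ⟨φ_a g, f⟩ =
⟨H_(a,g), f⟩ for all f ∈ S_k. Read FORWARD this is a theorem; read BACKWARD it is a Berezin–Toeplitz
statement — g ↦ π_hol(φ g) is the Toeplitz operator with symbol φ on weight-k forms and the
covariant symbol of ANY operator between the ψ- and χψ-spaces transforms with χ, while Berezin's
transform tends to the identity as k → ∞ (Radulescu1998 pp. 8, 19; doi:10.1007/bf02790207) — so
automorphy of φ_a is equivalent to modularity of its shadows, an infinite system of LINEAR
identities in REGULAR weight, each testable against an exact basis of S_k and falsifiable by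
finitely many coefficients (calibrated: kit job j002740, dihedral level 145). Imported areas:
Berezin–Toeplitz quantization of the upper half-plane (operator theory) and
shifted-convolution/holomorphic-projection technique (analytic number theory, used here in the
direction opposite to DFI/Blomer–Harcos), aimed at the even-Artin gap recorded by Booker2006 §1 and
Calegari2023 §12. No prior route of this summit leaves weight 0/1 on the automorphic side without
changing the group (GaloisWeightedBE, RationalPeriodQuarter, EvenArtinQuantumBoundary stay at the
singular parameter; EvenArtinGL4Door, BianchiArtinPoints change group or prime); the negatives index
(1 entry, Kuga–Satake anchor) is not touched. Rev 1 (cone route-repair): the Galois side is read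
through Frobenius characteristic polynomials at the good primes only (Euler pinning of the partial
L-series), so neither the Artin L-function nor the Artin conductor is in the vocabulary; the level
is existential.

RANKED CRUXES. #0 EvenStrongArtinSC (target) — EVEN STRONG ARTIN OVER ℚ over `FramedGaloisRep ℚ ℂ 2`
(definitionally the target stmt-Langlands-3310 of route EvenArtinQuantumBoundary): every irreducible
σ : Γ_ℚ → GL₂(ℂ) with det σ(c) = 1 has a cuspidal automorphic P on GL₂(𝔸_ℚ) whose Satake parameters
match the Frobenius characteristic polynomials of σ at almost all places. What X buys via
MaassEigenformStrongArtin and EvenArtinShadowData (support chain EvenArtinFromShadows); not a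
hypothesis of `closes`. (why it might fail: it is a case of (B); false iff some even (icosahedral) σ
is not automorphic — minimal prime conductor 1951 (DoudMoore2006 §4); no candidate counterexample is
known.) [DoudMoore2006, Booker2003, Booker2006, Calegari2023] #2 ShadowModularity (crux) — SHADOW
MODULARITY (card K2, the bet; rev 1 typing). For every irreducible σ and all Artin data (N > 0, χ
mod N, ε = ±1 with σ(c) = ε·1, a Euler-pinned to σ away from N: a₁ = 1, multiplicative, a(p^(j+1)) =
0 for p ∣ N, and for p ∤ N σ unramified with charpoly(Frob_p) = X² − a_p X + χ(p) and a(p^(j+2)) =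
a_p a(p^(j+1)) − χ(p) a(p^j)) there is a level L₀ > 0 with N ∣ L₀ such that for every weight k ≥ 4,
every level L with L₀ ∣ L, every ψ mod L and every g = Σ b_m q^m ∈ S_k(Γ₀(L), ψ) (q-series,
holomorphic, g|γ = ψ(d)(cz+d)^k g, y^(k/2)|g| bounded) the shadow series converge absolutely and
H_(a,ε,g) = Σ c_m q^m is a cusp form in S_k(Γ₀(L), χψ) in the same four-clause sense. TRUE if σ is
automorphic (witness: φ_a is the level-N₀ Maass newform of σ with its Euler factors at p ∣ N
stripped, automorphic of level dividing L₀ = lcm(N, N₀·Π_(p∣N) p²); then Sturm forward =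
ShadowNecessity); conversely (ShadowConverse + MaassEigenformStrongArtin) any admissible datum with
modular shadows makes σ automorphic: each instance is an exact linear identity in regular weight.
[difficulty: open-problem] (why it might fail: It is (B) for even ρ in disguise: false iff some even
icosahedral ρ (minimal prime conductor 1951, DoudMoore2006) is not automorphic; no proof engine yet
(card K2 (i)/(ii)); a certified non-modular shadow of the true data is evidence against it.)
[Sturm1980, GrossZagier1986, Booker2006, Booker2003, DoudMoore2006, DiamondShurman2005] #3
ShadowConverse (crux, unchanged) — SHADOW CONVERSE THEOREM (card K1 in the refuter's Berezin form).
N ∣ L (N, L ≥ 1), χ mod N, ψ mod L, ε = ±1, a with ‖a_n‖ ≤ C(n+1)^A, k₀ arbitrary: if for every k ≥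
k₀ and every g ∈ S_k(Γ₀(L), ψ) the shadow H_(a,ε,g) converges and lies in S_k(Γ₀(L), χψ), then
φ_(a,ε)(γz) = χ(d_γ) φ_(a,ε)(z) for all γ ∈ Γ₀(L). Proof sketch: A_k : g ↦ H_(a,g) is linear
S_k(L,ψ) → S_k(L,χψ) with ⟨A_k g, P_m⟩ = ∫_strip φ_a g ē_m y^k dμ; its covariant symbol σ_k(z) =
(A_k K^ψ_z)(z)/K^ψ_z(z) satisfies σ_k(βz) = χ(β)σ_k(z) for any operator, and unfolding the
Γ_∞-periodised Bergman seed gives σ_k = κ_k·(Berezin transform of φ_a) + off-diagonal Γ₀(L)-terms →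
κ_k φ_a pointwise at non-elliptic z as k → ∞ (BerezinLocalization); continuity finishes. [deps:
BerezinLocalization] [difficulty: XL] (why it might fail: the symbol limit is for the FORMAL
operator: it needs the off-diagonal Γ₀(L) Bergman terms exponentially small against the y^(−A)
boundary growth of φ_a and the m'-sum/strip-integral interchange at large k; if either uniformity
fails, π_hol keeps a kernel and automorphy does not follow.) [Radulescu1998, Sturm1980,
doi:10.1007/bf02790207, Iwaniec2002, DiamondShurman2005] #4 DeltaTowerConverse (crux, unchanged) —
SINGLE-FAMILY (Δ-TOWER) CONVERSE — the completeness question behind the finite test. N ≥ 1, χ even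
mod N, ε = ±1, a polynomially bounded: if for every j ≥ 1 the shadow of (a, ε) against g = Δ^j
(weight 12j, level N, trivial ψ) converges and lies in S_(12j)(Γ₀(N), χ), then φ_(a,ε) is
Γ₀(N)-automorphic with character χ. Not on the `closes` path; TRUE makes strong Artin for each even
ρ equivalent to the countable explicit family of linear identities H_(ρ,Δ^j) ∈ S_(12j)(N, det ρ)
that the calibrated kit protocol (j002740) tests; FALSE calibrates how many (k, g) a test needs.
[deps: ShadowConverse] [difficulty: L] (why it might fail: at fixed weight π_hol has
infinite-dimensional kernel and one g per weight gives no reproducing-kernel argument; completeness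
in the weight aspect is a Müntz-type problem.) [Sturm1980, Radulescu1998, GrossZagier1986] #5
SectorComplement (crux — the JUNCTION, owned by this route; rank 5, last among the cruxes; rev 8
stated over the output of X) — RECIPROCITY OUTSIDE THE EVEN-ARTIN SLICE, READ FROM THE MAASS SIDE:
`Langlands` GIVEN that for every irreducible σ : Γ_ℚ → GL₂(ℂ) and every admissible Artin datum (N >
0, χ mod N, ε = ±1 with σ(c) = ε·1, ‖a_n‖ ≤ C(n+1)^A, a Euler-pinned to σ away from N) there is a
level L > 0, N ∣ L, with φ_(a,ε)(γz) = χ(d_γ) φ_(a,ε)(z) on Γ₀(L) — i.e. global Langlands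
reciprocity for GL_n over every number field, both directions, local–global compatibility at every
finite place (the summit exactly as typed: ∀ F ∃ 𝓡 ∀ n ≥ 1 ∀ hcpt, (A) ∧ (B)) GIVEN classical even
strong Artin over ℚ in Maass-form form (vacuous for odd σ, whose σ(c) is never scalar). Content
beyond X: the Maass-eigenform dictionary of the slice (automorphic φ_(a,ε) + Euler pin ⇒ cuspidal P
with Satake–Frobenius matching a.e.; known in substance and filed on its own as the support
MaassEigenformStrongArtin — `sectorComplement_of_old` in Sketch.lean derives the rev-8 junction from
the rev-6 one, `EvenStrongArtinSC → Langlands`, plus the two dictionaries, so the restatement added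
no uncertainty); direction (A) for all (n, F) — including the (A)-twin of this very slice: ρ_π for
an L-algebraic cuspidal π of GL₂(𝔸_ℚ) whose π_∞ is the eigenvalue-1/4 principal series (a weight-0
Maass eigenform), which no cohomology constructs (Calegari2023; NonRegularWeightBarrier) — direction
(B) for every irreducible geometric ρ other than even Artin Γ_ℚ → GL₂ (regular weights over CM
fields: automorphy lifting / potential automorphy, AllenCalegariCaraianiGeeEtAl2023; irregular
weights and general F: open), inside the slice the upgrade from a.e. Satake matching to
`Corresponds` (rec_v at every finite v, TaylorGaloisRepresentations2004 Conj. 7), and the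
reciprocity data 𝓡 (shared Statement debt). It is the hypothesis hC of `closes`, the only one
besides X = (ShadowModularity, ShadowConverse); it closes by name from any proof of `Langlands`
(`sectorComplement_of_langlands`, one line) or from the complementary sector theorems as the
summit's other routes land them, and it can only die together with a negative decision of the
Statement as typed while the Maass automorphy of even Artin data stands. Ranked last because it is
the least specific to this line's mechanism (the informative cruxes are #2/#3) while the hardest in
absolute terms. [deps: none by name; EvenStrongArtinSC in content] [difficulty: open-problem] (why
it might fail: it is `Langlands` minus one thin sector: false iff every admissible even Artin datum
has an automorphic Maass lift while reciprocity fails elsewhere — an irreducible geometric ρ of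
irregular weight or over a non-CM field with no automorphic π, direction (A) off Shimura varieties,
or ∃ 𝓡 unrealizable for the placeholder-typed p-adic Hodge data.) [BuzzardGeeLMS2014,
FontaineMazurGeometric1995, TaylorGaloisRepresentations2004, Calegari2023,
AllenCalegariCaraianiGeeEtAl2023, KhareWintenberger2009, Gelbart1975, Bump1997] #9
MaassEigenformStrongArtin (support, rev 1 typing) — MAASS-EIGENFORM DICTIONARY (hand-off, known in
substance: Gelbart1975 §3, Bump1997 §3.2/§3.6, Iwaniec2002 Ch. 4/6/8 for Maass forms with nebentypus
and their Hecke operators; strong multiplicity one is not even needed). For irreducible σ, N ∣ L, L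
≥ 1, ε = ±1, a polynomially bounded and Euler-pinned to σ away from N: if φ_(a,ε)(γz) =
χ(d_γ)φ_(a,ε)(z) on Γ₀(L), then σ has a cuspidal P with Satake–Frobenius matching a.e. (the
EvenStrongArtinSC conclusion). Content: φ_(a,ε) ≠ 0 (a₁ = 1) is real-analytic of moderate growth
with Δφ = −φ/4 termwise; multiplicativity + the degree-2 recursion at p ∤ L make it a
T_p-eigenfunction (p ∤ L) with eigenvalues a_p = tr σ(Frob_p) and ⟨p⟩ = χ(p) = det σ(Frob_p); an
Eisenstein component would force tr σ(Frob_p) = χ₁(p)+χ₂(p) for almost all p, i.e. σ ≅ χ₁ ⊕ χ₂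
(Chebotarev + Brauer–Nesbitt), contradicting irreducibility, so φ is cuspidal and any irreducible
constituent π of the representation it generates has π_p unramified with Satake polynomial X² − a_pX
+ χ(p) = charpoly σ(Frob_p) for p ∤ L. [difficulty: XL] [Gelbart1975, Bump1997, Iwaniec2002,
DiamondShurman2005] #9 EvenArtinShadowData (support, rev 1 typing) — ARTIN DATA OF AN EVEN ρ
(routine Artin formalism over PROVED tree theorems): for irreducible even σ there are N > 0, a
Dirichlet character χ mod N, ε ∈ {1, −1} and a : ℕ → ℂ with σ(c) = ε·1 for every complex conjugation
c (an involution of determinant 1 in GL₂(ℂ) is ±1), ‖a_n‖ ≤ C(n+1)^A, and the Euler pin. Witness: σ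
has finite image (ArtinRep.finite_range_holds) hence is unramified outside a finite set S
(ArtinRep.isUnramifiedAE, proved); det σ is a finite-order character, so by Kronecker–Weber
(KroneckerWeber_holds + exists_dirichletCharacter_of_kroneckerWeber, both proved in the tree) there
is a Dirichlet character χ₀ of some modulus M with χ₀(p) = det σ(Frob_p) for p ∤ M; take N =
M·Π_(p∈S) p, χ = χ₀ mod N, and define a multiplicatively from a(p^j) := 0 (p ∣ N, j ≥ 1) and the
recursion seeded by a_p := tr σ(Frob_p) (p ∤ N; well defined by
hasFrobCharpolyAt_frobCharpoly_holds); eigenvalues are roots of unity, so |a_(p^j)| ≤ j+1 and |a_n|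
≤ d(n) ≤ 2(n+1)^(1/2). A prover's Theorems file may import those Literature modules freely (the cone
guardrail concerns the route file only). [difficulty: L] [SerreAbelianLadic1968, Martinet1977,
DiamondShurman2005] #9 ShadowNecessity (support, unchanged) — STURM FORWARD FOR THIS KERNEL (known:
Sturm1980 Thm 1, p. 436 — F ∈ 𝔊(k,N,χ,b): C^∞, F(γz) = χ(d) j(k,γ,z) F(z) on Γ₀(N), |F| ≤ C(y^a +
y^(−b)), k > 2, b < k − 1 ⟹ h = Σ c(n)e(nz) ∈ S(k,N,χ) with c(n) = (4πn)^(k−1)Γ(k−1)^(−1)∫_0^∞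
a(n,y)e^(−2πny)y^(k−2)dy and ⟨g,F⟩ = ⟨g,h⟩; here F = φ_(a,ε)·g has b = k/2; GrossZagier1986 §IV.5
(5.1)–(5.2) for the weight-2 correction we avoid). If φ_(a,ε) (‖a_n‖ ≤ C(n+1)^A, ε = ±1) is
Γ₀(N)-automorphic with character χ and bounded, then for every k ≥ 4 with k > 2A + 4, every L ≥ 1
with N ∣ L, ψ mod L and g ∈ S_k(Γ₀(L), ψ), the shadow converges and lies in S_k(Γ₀(L), χψ). Not on
the `closes` path; it makes a certified non-modular shadow of the true data of ρ a refutation of the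
Maass newform predicted for ρ, i.e. evidence against EvenStrongArtinSC. [difficulty: L] [Sturm1980,
GrossZagier1986, Iwaniec2002] #9 BerezinLocalization (support, unchanged) — BEREZIN TRANSFORM →
IDENTITY ON POLYNOMIALLY BOUNDED CONTINUOUS FUNCTIONS (provable now over Mathlib's measure and
metric on ℍ; Radulescu1998 Introduction for bounded symbols): for φ continuous with ‖φ(z)‖ ≤ C(y^A +
y^(−A)) and every z₀, (k−1)/(4π) ∫_ℍ cosh(d(z,z₀)/2)^(−2k) φ(z) dμ(z) → φ(z₀) as k → ∞. The analytic
heart of ShadowConverse (its foreseen layer-2 child). [difficulty: provable-now] [Radulescu1998,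
Iwaniec2002] #9 EvenArtinFromShadows (support, rev 5) — SLICE GLUE, provable now by pure logic (term
`evenArtinFromShadows_holds` in the planner's Sketch.lean): ShadowModularity → ShadowConverse →
MaassEigenformStrongArtin → EvenArtinShadowData → EvenStrongArtinSC, i.e. X with the two
dictionaries proves the target BY NAME (the body of `closes` up to its last step: Artin data, good
level L₀, ShadowConverse at (N, L₀, χ, ψ = 1, k₀ = 4), Maass dictionary). Filed so that an item of
the route concludes the target by name (target reachability); OFF the deciding path since rev 8 —
`closes` = SectorComplement ∘ (ShadowModularity, ShadowConverse) passes neither through the target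
nor through the dictionaries — and any idle prover closes it with the Sketch term. [difficulty:
provable-now] [Sturm1980, Radulescu1998]

TWO-LAYER PLAN. Foreseen glued splits (k ≤ 3, depth 1), filed only after a crux closes or stalls
with a census: ShadowConverse ⇐ [StripUnfolding: ⟨A_k g, f⟩ = ∫_strip φ_a g h̄_f y^k dμ for Poincaré
combinations incl. the Bergman seed, k > 2A + 2] → [SymbolCovariance + off-diagonal decay at
non-elliptic points] → [BerezinLocalization, already filed] → ShadowConverse. ShadowModularity ⇐ (i)
[Rankin–Selberg unfolding of H_(ρ,g) against f·E(z,s) with Brauer functional equations] or (ii)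
[Λ-adic interpolation of κ ↦ H_(ρ,g_κ)/Ω_κ along a Hida family of g] — whichever acquires an engine
first; MaassEigenformStrongArtin ⇐ [moderate growth + Hecke from multiplicativity] → [cuspidality
from irreducibility] → [Maass eigenform → π, Satake = X² − a_pX + χ(p)].

KILL CRITERIA. A certified instance of a non-modular shadow of the TRUE data of the minimal even
icosahedral ρ (prime conductor 1951, DoudMoore2006 §4; N = 1951, a = partial Dirichlet coefficients,
χ = det ρ), g = Δ, k = 12, at a level L that is a multiple of 1951²: the first Sturm-bound-many c_m
violate an exact rational linear relation of S_12(Γ₀(L), det ρ) by more than the certified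
truncation error. Via ShadowNecessity this says the predicted Maass newform is not automorphic,
hence (newform theory) NO admissible datum has a good level L₀ — close `refuted:ShadowModularity`
with the certificate as evidence and hand it to a refutation route for the even slice of (B). A
non-automorphic polynomially bounded a whose shadows are all modular refutes ShadowConverse: pivot
to the converse restricted to Euler-pinned (Hecke-multiplicative) a or retire. DeltaTowerConverse
refuted alone does not close the route (it calibrates the test). EvenStrongArtinSC /
stmt-Langlands-3310 proved elsewhere (Booker-type certificate, GaloisWeightedBE,
RationalPeriodQuarter…) moots the route's target but not ShadowConverse. SectorComplement (the
junction) has no refutation of its own short of a negative decision of `Langlands` as typed (e.g. an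
unrealizability theorem for ∃ 𝓡) with the Maass automorphy of even Artin data (equivalently, through
the dictionary, EvenStrongArtinSC) standing; that event re-targets every sector route of the summit
at the corrected Statement and is handled by the operator/tenure planner, not by closing this line.

NOT DECOMPOSED YET. The proof engine for ShadowModularity (card K2 (i) Rankin–Selberg/Brauer, (ii)
Hida-family interpolation of shadows) — no typable statement yet; the Poincaré-series /
Petersson-formula / reproducing-kernel infrastructure for Γ₀(L) with character (layer-2 children of
ShadowConverse); the single-weight question (does ONE weight k with all g suffice?); the certified
interval-arithmetic protocol for c_m (kit, not Lean); the structural lemma 'singularity is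
absorbing' (card P1, folklore) is rationale, not an item; whether the existential level L₀ of
ShadowModularity can be pinned to lcm(N, N₀²) without re-importing the conductor; the split of
MaassEigenformStrongArtin into [classical Maass newform with nebentypus → adelic automorphic form on
GL₂(𝔸_ℚ) of level K₀(L)] → [stable span + irreducible constituent, via
automorphicForms_isStableSubmodule_holds / exists_cuspidalRepData_of_L2_holds] → [T_p-eigenvalue →
HasSatakeParamAt, via heckePolynomial_eq_satakePolynomial_holds] waits for a prover's census
(support item, not staffed first). SectorComplement is never split inside this route: its natural
pieces ((A) for all n, F; (B) in regular / irregular weight; local–global compatibility; the data 𝓡)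
are the theses of the summit's other routes and reach this item by name, not as a third layer here;
its one provable piece, the Maass-eigenform dictionary, is already the support
MaassEigenformStrongArtin (with EvenArtinShadowData), through which the rev-6 form
`EvenStrongArtinSC → Langlands` — e.g. a proof of `Langlands` or of all complementary sectors
elsewhere — still discharges it (`sectorComplement_of_old`).

CHEAPEST FALSIFIER. Already run by the card author (kit pari j002639/j002721 smoke, j002740 full,
script holoshadow.gp): the TRUE dihedral even Maass form of level 145 (class-group character of
order 4 of ℚ(√145)) times Δ projects into S_12(Γ₀(145), χ_145) (dim 164, Sturm bound 180, 250
coefficients) to relative least-squares distance 8.8·10⁻¹³ and satisfies all 86 exact rational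
relations to ≤ 1.9·10⁻¹³, while the wrong-parity (0.63), fake-multiplicative (0.73) and
wrong-character (0.74) controls fail — so the typed normalisations are the live risk: the cheapest
kill of THIS route is a refuter re-deriving c_m for (level 145, k = 12) from the typed `coeff` (sign
sgn_ε, power y^(k−3/2), character convention g|γ = ψ(d) g; the gadgets are byte-identical across rev
0 and rev 1, so the refuter replication job j003658 filed on stmt-Langlands-11629 stays relevant)
and finding the true form fails; next cheapest, the conductor-1951 icosahedral test itself.

NUMBERS. Minimal prime conductor of an even icosahedral ρ: 1951; six primes < 10⁴ of type 3a; types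
3b/3c first at 10267 / 13613 (DoudMoore2006 §4, arXiv:math/0405534 p. 7). Calibration (j002740): dim
S_12(Γ₀(145), χ_145) = 164, Sturm bound 180, TRUE distance 8.8e-13 vs controls 0.63/0.73/0.74, 386 s
on one core. Sturm1980 Thm 1 hypotheses READ (p. 436): k > 2, growth exponent b < k − 1, same χ(d)
convention and constant (4πn)^(k−1)/Γ(k−1) as the typed `coeff`. Convergence thresholds typed:
ShadowModularity k ≥ 4 (|a_n| ≤ d(n) from the Euler pin, Hecke bound |b_m| ≪ m^(k/2), I_k(m,m') ≍
m'^(−k+1/2)); ShadowNecessity k > 2A + 4; Berezin kernel mass (k−1)/(4π)·∫cosh^(−2k)(d/2)dμ = 1.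
Items: 10 at open; 11 since rev 3 (1 target, 3 cruxes, 6 support, 1 assembly), unchanged at rev 4;
rev 5 (route-choice 2026-08-16): 12 items = 1 target, 4 cruxes (the junction, promoted by the
AUTO-CRUX sweep as OffEvenArtinSC and re-filed as the owned junction crux SectorComplement, stated
by name), 6 support (+ EvenArtinFromShadows, the provable-now slice glue), 1 assembly; `closes`
hypotheses unchanged (5). Rev 8 (route-choice gen 3, 2026-08-16): SectorComplement restated over the
output of X: 11 active items = 1 target, 4 cruxes (ShadowModularity r2, ShadowConverse r3,
DeltaTowerConverse r4, SectorComplement r5), 5 support (MaassEigenformStrongArtin,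
EvenArtinShadowData, ShadowNecessity, BerezinLocalization, EvenArtinFromShadows), 1 assembly
(restated at rev 9 as ShadowModularity → ShadowConverse → SectorComplement → Langlands, i.e.
`closes` as a Prop); `closes` hypotheses 5 → 3, all of kind crux — crux-only. Imports beyond the
Statement: 2 fact-carrying at open (rev 0), 0 at rev 3, 5 proof-carrying at rev 4
(GLnAdelicStructureProofs, LocalGaloisGroupProofs, LocalGaloisGroupFrobeniusProofs,
LocalConstantsProofs, LocalLanglandsGLProofs). Unproved named facts in the module cone: 14 (rev 0) →
12 (rev 3 = rev 4) = those of `Summits.Langlands.Langlands.Statement` itself (59-module cone; 68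
modules with the rev-4 imports, no new fact). Declaration cone (`#h21_route_deps`): 309 project
constants; closed facts without visible witness 5 (rev 3, all via the summit statement, all proved
in tree) → 0 (rev 4); direct fact-with-binders isCompact_glFiniteIntegralLevel witnessed at rev 4.

DEFINITION REQUESTS. None filed: K₀ (∫_0^∞ e^(−x cosh t) dt), the Maass lift φ_(a,ε), the
four-clause cusp-form predicate with nebentypus, the shadow coefficients, and (rev 1) the Euler pin
`EulerPin σ N χ a` and parity pin are written as `let` gadgets over Mathlib + the Statement's cone
(UpperHalfPlane, CongruenceSubgroup.Gamma0, DirichletCharacter, ModularForm.discriminant,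
volume/dist on ℍ, FramedGaloisRep.IsUnramifiedAt/HasFrobCharpolyAt) inside each item, byte-identical
across items so that `closes` is pure logic; if a Literature
`MaassForm`/`besselK`/`holomorphicProjection` notion lands, the tenure planner restates the items
against it.

Novelty: Searches (2026-08-15, this seat; searchd intermittently rc 75): grep of all 39 Langlands Theses for
'holomorphic projection|Sturm|shifted
convolution|Toeplitz|Berezin|π_hol' (0 hits); `ledger negatives --problem Langlands` (1 entry,
unrelated); `lit frontier Langlands --since
2021` (30 rows, none on holomorphic projection / Berezin quantization / even Artin numerics); `lit
bridges Langlands --cross any` (30 rows,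
none); `lit search --hybrid "Berezin transform Toeplitz operator automorphic forms weight covariant
symbol"` (12 docs, only generic
Berezin–Toeplitz texts, e.g.
book:floch2018-brief-introduction-berezintoeplitz-operators-compact-kahler-manifolds); `lit read
doi:10.1016/j.jnt.2005.08.008 --grep conductor` (minimal prime conductor 1951 confirmed, p. 7); `lit
galaxy search "holomorphic projection"
--star all` (16 rows: Gross–Zagier-formula monograph, SCV notes — none reads π_hol backwards), `lit
galaxy search "Berezin transform" --star all`
(16 rows: Bergman-kernel / Toeplitz operator theory generics, Krantz, Nikolski, Duren–Schuster),
`lit galaxy search "Berezin transform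
automorphic forms Toeplitz symbol" --star all` (0 rows); remote cascade (`lit search … --source
all`) unavailable this session (searchd rc 75 ×3); plus the card's own log (3 hybrid searches,
crossref Sturm/Doud–Moore, Booker read) and the refuter's audit aud-20 (Radulescu1998 READ pp. 8,
19; Unterberger–Unterberger
doi:10.1007/bf02790207; BMS CMP 165; Booker Exp. Math. 2000).
Nearest prior art found:  [refs: 10.1016/j.jnt.2005.08.008, 10.1007/bf02790207, 10.1090/memo/0630, math/0507502, book:floch2018-brief-introduction-berezintoeplitz-operators-compact-kahler-manifolds, doi:10.1016/j.jnt.2005.08.008, doi:10.1007/bf02790207, doi:10.1090/memo/0630, Radulescu1998, Sturm1980, GrossZagier1986, Booker2006, Booker2003, DoudMoore2006]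

Barriers (technique_class: holomorphic-projection shifted-convolution converse): - technique_class: holomorphic-projection shifted-convolution converse
- Literature.Barriers.Langlands.NonRegularWeightBarrier: evaded for the STATEMENTS — the singular
form φ_ρ (type maassQuarterInfinityType) is never realised in cohomology or interpolated p-adically;
only its shadows are, and they live in regular weight k ≥ 4 where exact bases exist; conceded that
the barrier bites again inside any proof of ShadowModularity that re-enters the critical strip of
L(s, ρ⊗·).
- Literature.Barriers.Langlands.ShtukaConstantFieldBarrier: no product over a constant field and no
moduli of shtukas; the 'second leg' lent to the singular form is a holomorphic cusp form g via
pointwise multiplication, a non-tensorial operation outside the barrier's technique class; conceded: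
this buys a reformulation, a converse theorem and a test, not yet a proof.
- Literature.Barriers.Langlands.SolvableImageBarrier: it does not evade it; no base change or cyclic
descent is used at all — the bet is that linear identities in regular weight are a handle on
icosahedral ρ that solvable methods cannot be; the route is scored on whether ShadowModularity
acquires an engine.
- Literature.Barriers.Langlands.ShimuraVarietyRealizationBarrier: not engaged (F = ℚ, n = 2, no
Galois representation is constructed; direction (B) only).
- Literature.Barriers.Langlands.TaylorWilesNumericalCoincidence: not engaged — no deformation ring,
no patching; likewise PatchingLocalComponentBarrier, ResiduallyReducibleBarrier, ModPLa

History (route lifecycle, newest last):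
- 2026-08-15T19:03:55Z · rev 3: restated ShadowModularity (stmt-Langlands-11629), MaassEigenformStrongArtin (stmt-Langlands-11632), EvenArtinShadowData (stmt-Langlands-11633), Assembly (stmt-Langlands-11636) — route-repair (cone guardrail, rrepair-Langlands-HolomorphicShadow-1d21ff1a) step 2/2: every item typed over the cone of Summits.Langlan (planner-rrepair-Langlands-HolomorphicShadow-1d21ff1a-0)
- 2026-08-15T19:03:55Z · rev 3: dropped EvenStrongArtin, OffEvenArtin — route-repair (cone guardrail, rrepair-Langlands-HolomorphicShadow-1d21ff1a) step 2/2: every item typed over the cone of Summits.Langlands.Statement alone. Resta (planner-rrepair-Langlands-HolomorphicShadow-1d21ff1a-0)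
- 2026-08-16T02:19:05Z · AUTO-CRUX: 1 conjecture-grade item(s) promoted to crux (OffEvenArtinSC) — refuter vetting / tiering apply (operator:999:1362873)
- 2026-08-16T03:02:36Z · rev 5: restated OffEvenArtinSC (stmt-Langlands-13062) — route-choice (partial-claim hold, operator 2026-08-16T02:41Z; unit rchoice-Langlands-HolomorphicShadow-pa-37d1e7cd): option (a) ADD THE REMAINDER AS A CRUX. Off (planner-rchoice-Langlands-HolomorphicShadow-pa-37d1e7cd-0)
- 2026-08-16T04:07:57Z · rev 8: restated SectorComplement (stmt-Langlands-14152) — route-choice gen 3 (partial-claim hold of 02:41Z still set after rev 5/6): option (a) re-executed under the crux-only deciding-theorem rule — the owned junction (planner-rchoice-Langlands-HolomorphicShadow-pa-37d1e7cd-g3-0)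
- 2026-08-16T04:14:39Z · rev 9: restated Assembly (stmt-Langlands-14151) — route-choice gen 3, follow-up: Assembly item restated 1:1 to the crux-only shape of the rev-8 deciding theorem (ShadowModularity → ShadowConverse → SectorComple (planner-rchoice-Langlands-HolomorphicShadow-pa-37d1e7cd-g3-0)
- 2026-08-25T07:20:23Z · DORMANT — reconciler: no traction for 7.5 d (last activity item-evidence-added at 2026-08-17T19:05:05Z); parked, not closed — `ledger route dormant route-Langlands-Holomo (operator:999:479121)
- 2026-08-29T00:28:08Z · REACTIVATED — reconciler: reactivated — activity statement-checked at 2026-08-28T21:32:13Z after parking at 2026-08-25T07:20:23Z (operator:999:4157340)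

sub-problem: Langlands · status: open · opened planner-plancard-Langlands-Langlands-holomorp-7c4c8d06-0 2026-08-15T18:32:36Z · rev 10 · ledger route-Langlands-HolomorphicShadow
GENERATED by the gate from the ledger (D-0016/17). Provers cite these decls: `theorem foo : Summit.Langlands.Langlands.Theses.HolomorphicShadow.<Decl> := …` in Summits/Langlands/Langlands/Theorems/<Name>.lean.
-/

namespace Summit.Langlands.Langlands.Theses.HolomorphicShadow

open scoped BigOperators Topology Manifold Classical MeasureTheory ProbabilityTheory Matrix InnerProductSpace ComplexConjugate ContinuousMap
open Filter Set Function TopologicalSpace MeasureTheory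

attribute [summit_statement] _root_.Langlands

/-- item stmt-Langlands-13061 · target · rank 0 · open · by planner
why it might fail: It is a case of (B): false iff some even icosahedral σ (minimal prime conductor 1951, DoudMoore2006 §4) is not automorphic; no candidate counterexample is known (Booker2003: then L(s,σ) has infinitely many poles).
sources: DoudMoore2006, Booker2003, Booker2006, Calegari2023
[target] EVEN STRONG ARTIN OVER ℚ, typed over the cone of Summits.Langlands.Statement (route-repair
2026-08-15): every irreducible σ : Γ_ℚ → GL₂(ℂ) (FramedGaloisRep ℚ ℂ 2) with det σ(c) = 1 at every
complex conjugation has a cuspidal automorphic P on GL₂(𝔸_ℚ) whose Satake parameters match the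
arithmetic-Frobenius characteristic polynomials of σ at almost all finite places. DEFINITIONALLY
EQUAL to stmt-Langlands-3310 (EvenStrongArtin of route EvenArtinQuantumBoundary): `FramedArtinRep K
n := FramedGaloisRep K ℂ n` is an abbrev, so a proof of either closes the other by `id`. Known for
solvable projective image (Langlands–Tunnell), OPEN for icosahedral image (Calegari ICM 2022 §12;
minimal prime conductor 1951, DoudMoore2006 §4). What X = ShadowModularity ∧ ShadowConverse buys via
MaassEigenformStrongArtin and EvenArtinShadowData; not a hypothesis of `closes` (OffEvenArtinSC
inlines it). [difficulty: open-problem] -/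
@[route_item "route-Langlands-HolomorphicShadow"]
def EvenStrongArtinSC : Prop :=
  ∀ σ : Literature.NumberTheory.GaloisRepresentations.FramedGaloisRep ℚ ℂ 2, σ.toGaloisRep.IsIrreducible → (∀ (φ : ℚ →+* ℝ) (c : Field.absoluteGaloisGroup ℚ), Literature.NumberTheory.GaloisRepresentations.IsComplexConjugation φ c → Matrix.GeneralLinearGroup.det (σ c) = 1) → ∃ (hcpt : Literature.NumberTheory.Automorphic.isCompact_glFiniteIntegralLevel 2 ℚ) (P : Literature.NumberTheory.Automorphic.CuspidalAutomorphicRepData 2 ℚ hcpt), (∀ᶠ v : IsDedekindDomain.HeightOneSpectrum (NumberField.RingOfIntegers ℚ) in Filter.cofinite, ∃ α : Multiset ℂ, Literature.NumberTheory.Automorphic.AutomorphicRepData.HasSatakeParamAt P.1 v α ∧ Literature.NumberTheory.GaloisRepresentations.FramedGaloisRep.IsUnramifiedAt v σ ∧ Literature.NumberTheory.GaloisRepresentations.FramedGaloisRep.HasFrobCharpolyAt v (Literature.NumberTheory.Automorphic.satakePolynomial α) σ)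

-- earlier ShadowModularity (stmt-Langlands-11629, replaced 2026-08-15T19:03:55Z -> stmt-Langlands-13894): retired by None — let K0 : ℝ → ℝ := fun x => ∫ t in Set.Ioi (0 : ℝ), Real.exp (-(x * Real.cosh t)); let IsCusp : ℕ → ℕ → (ℤ → ℂ) → (UpperHalfPlane → ℂ) → (ℕ → ℂ) → Prop := fun k L ω g b => (∀ z : UpperHalfPlane, HasSum (fun m : ℕ => b (m + 1) * Complex.exp (2 * Real.pi * Complex.I * ((m : ℂ) + 1
/-- item stmt-Langlands-13894 · crux · rank 2 · open · by planner
why it might fail: It is (B) for even ρ in disguise: false iff some even icosahedral ρ (minimal prime conductor 1951, DoudMoore2006) is not automorphic; no proof engine yet (card K2 (i)/(ii)); a certified non-modular shadow of the true data is evidence against it.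
sources: Sturm1980, GrossZagier1986, Booker2006, Booker2003, DoudMoore2006, DiamondShurman2005
[crux] SHADOW MODULARITY (card K2, the bet; rev 1 typed over the Statement cone). For every
irreducible σ : Γ_ℚ → GL₂(ℂ) and all Artin data (N > 0; χ a Dirichlet character mod N; ε = ±1 with
σ(c) = ε·1 at every complex conjugation; a : ℕ → ℂ Euler-pinned to σ away from N: a₁ = 1, a
multiplicative, a(p^(j+1)) = 0 for primes p ∣ N, and for primes p ∤ N: σ unramified at p with
charpoly σ(Frob_p) = X² − a_p X + χ(p) (arithmetic Frobenius) and a(p^(j+2)) = a_p a(p^(j+1)) − χ(p)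
a(p^j) — i.e. a = Dirichlet coefficients of the partial Artin L-function L^N(s,σ)) there is a level
L₀ > 0 with N ∣ L₀ such that for every weight k ≥ 4, every level L with L₀ ∣ L, every ψ mod L and
every g = Σ b_m q^m ∈ S_k(Γ₀(L), ψ) (q-series, holomorphic, g|γ = ψ(d)(cz+d)^k g, y^(k/2)|g|
bounded) the shadow series converge absolutely and H_(a,ε,g) = Σ c_m q^m is a cusp form in
S_k(Γ₀(L), χψ) in the same four-clause sense. TRUE if σ is automorphic (φ_a = the Maass newform of σ
with its Euler factors at p ∣ N stripped, automorphic of level dividing lcm(N, N₀·Π_(p∣N)p²); then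
Sturm forward); with ShadowConverse + MaassEigenformStrongArtin any admissible datum with modular
shadows makes σ automorphic. Replaces rev -/
@[route_item "route-Langlands-HolomorphicShadow", crux]
def ShadowModularity : Prop :=
  let K0 : ℝ → ℝ := fun x => ∫ t in Set.Ioi (0 : ℝ), Real.exp (-(x * Real.cosh t)); let IsCusp : ℕ → ℕ → (ℤ → ℂ) → (UpperHalfPlane → ℂ) → (ℕ → ℂ) → Prop := fun k L ω g b => (∀ z : UpperHalfPlane, HasSum (fun m : ℕ => b (m + 1) * Complex.exp (2 * Real.pi * Complex.I * ((m : ℂ) + 1) * (z : ℂ))) (g z)) ∧ MDifferentiable (modelWithCornersSelf ℂ ℂ) (modelWithCornersSelf ℂ ℂ) g ∧ (∀ γ ∈ CongruenceSubgroup.Gamma0 L, ∀ z : UpperHalfPlane, g (γ • z) = ω ((γ : Matrix (Fin 2) (Fin 2) ℤ) 1 1) * ((((γ : Matrix (Fin 2) (Fin 2) ℤ) 1 0 : ℤ) : ℂ) * (z : ℂ) + (((γ : Matrix (Fin 2) (Fin 2) ℤ) 1 1 : ℤ) : ℂ)) ^ k * g z) ∧ ∃ C : ℝ, ∀ z : UpperHalfPlane,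 z.im ^ ((k : ℝ) / 2) * ‖g z‖ ≤ C; let Ik : ℕ → ℕ → ℕ → ℝ := fun k m m' => ∫ y in Set.Ioi (0 : ℝ), y ^ ((k : ℝ) - 3 / 2) * K0 (2 * Real.pi * |(m : ℝ) - (m' : ℝ)| * y) * Real.exp (-(2 * Real.pi * ((m : ℝ) + (m' : ℝ)) * y)); let term : (ℕ → ℂ) → ℂ → ℕ → (ℕ → ℂ) → ℕ → ℕ → ℂ := fun a ε k b m m' => if m' = 0 ∨ m' = m then 0 else (if m' < m then a (m - m') else ε * a (m' - m)) * b m' * ((Ik k m m' : ℝ) : ℂ); let coeff : (ℕ → ℂ) → ℂ → ℕ → (ℕ → ℂ) → ℕ → ℂ := fun a ε k b m => (((4 * Real.pi * (m : ℝ)) ^ (k - 1) / Real.Gamma ((k : ℝ) - 1) : ℝ) : ℂ) * ∑' m' : ℕ, term a ε k b m m'; let shadow : (ℕ → ℂ) → ℂ → ℕ → (ℕ → ℂ) → UpperHalfPlane → ℂ := fun a ε k b z => ∑' m : ℕ, coeff a ε k b (m + 1) * Complex.exp (2 * Real.pi * Complex.I * ((m : ℂ) + 1) * (z : ℂ)); let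 ShadowInS : (ℕ → ℂ) → ℂ → ℕ → (ℕ → ℂ) → ℕ → (ℤ → ℂ) → Prop := fun a ε k b L ω => (∀ m : ℕ, Summable (term a ε k b m)) ∧ IsCusp k L ω (shadow a ε k b) (coeff a ε k b); let EulerPin : Literature.NumberTheory.GaloisRepresentations.FramedGaloisRep ℚ ℂ 2 → (N : ℕ) → DirichletCharacter ℂ N → (ℕ → ℂ) → Prop := fun σ N χ a => a 1 = 1 ∧ (∀ m n : ℕ, Nat.Coprime m n → a (m * n) = a m * a n) ∧ (∀ p : ℕ, p.Prime → p ∣ N → ∀ j : ℕ, a (p ^ (j + 1)) = 0) ∧ (∀ p : ℕ, p.Prime → ¬ p ∣ N → (∀ j : ℕ, a (p ^ (j + 2)) = a p * a (p ^ (j + 1)) - χ (p : ZMod N) * a (p ^ j)) ∧ ∀ v : IsDedekindDomain.HeightOneSpectrum (NumberField.RingOfIntegers ℚ), (p : NumberField.RingOfIntegers ℚ) ∈ v.asIdeal → Literature.NumberTheory.GaloisRepresentations.FramedGaloisRep.IsUnramifiedAt v σ ∧ Literature.NumberTheory.GaloisRepresentations.FramedGaloisRep.HasFrobCharpolyAt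 v (Polynomial.X ^ 2 - Polynomial.C (a p) * Polynomial.X + Polynomial.C (χ (p : ZMod N))) σ); let ParityPin : Literature.NumberTheory.GaloisRepresentations.FramedGaloisRep ℚ ℂ 2 → ℂ → Prop := fun σ ε => ∀ (φ : ℚ →+* ℝ) (c : Field.absoluteGaloisGroup ℚ), Literature.NumberTheory.GaloisRepresentations.IsComplexConjugation φ c → ((σ c : GL (Fin 2) ℂ) : Matrix (Fin 2) (Fin 2) ℂ) = ε • (1 : Matrix (Fin 2) (Fin 2) ℂ); ∀ σ : Literature.NumberTheory.GaloisRepresentations.FramedGaloisRep ℚ ℂ 2, σ.toGaloisRep.IsIrreducible → ∀ (N : ℕ) (χ : DirichletCharacter ℂ N) (ε : ℂ) (a : ℕ → ℂ), 0 < N → (ε = 1 ∨ ε = -1) → ParityPin σ ε → EulerPin σ N χ a → ∃ L₀ : ℕ, 0 < L₀ ∧ N ∣ L₀ ∧ ∀ k : ℕ, 4 ≤ k → ∀ L : ℕ, L₀ ∣ L → 0 < L → ∀ (ψ : DirichletCharacter ℂ L) (b : ℕ → ℂ) (g : UpperHalfPlane → ℂ), IsCusp k L (fun d : ℤ => ψ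 (d : ZMod L)) g b → ShadowInS a ε k b L (fun d : ℤ => χ (d : ZMod N) * ψ (d : ZMod L))

/-- item stmt-Langlands-11630 · crux · rank 3 · open · by planner
why it might fail: Unproved anywhere. Covariance σ_k(βz)=χ(d)σ_k(z) is exact given the hypothesis, but recovery σ_k→φ_a needs K^ψ_z(z)≠0, off-diagonal Γ_∞\Γ₀(L) strip-Bergman terms exponentially small against the y^(−A−1/2) growth of φ_a (not uniform for y ≳ √k: Auvray–Ma–Marinescu) and Fubini at k>2A+3.
sources: Radulescu1998, doi:10.1007/bf02790207, doi:10.1007/s00208-020-01957-y, Sturm1980, Iwaniec2002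
[crux] SHADOW CONVERSE THEOREM (card K1 in the refuter's Berezin form). N ∣ L (N, L ≥ 1), χ mod N, ψ
mod L, ε = ±1, a with ‖a_n‖ ≤ C(n+1)^A, k₀ arbitrary: if for every k ≥ k₀ and every g ∈ S_k(Γ₀(L),
ψ) the shadow H_(a,ε,g) converges and lies in S_k(Γ₀(L), χψ), then φ_(a,ε)(γz) = χ(d_γ) φ_(a,ε)(z)
for all γ ∈ Γ₀(L). Proof sketch: A_k : g ↦ H_(a,g) is linear S_k(L,ψ) → S_k(L,χψ) with ⟨A_k g, P_m⟩
= ∫_strip φ_a g ē_m y^k dμ; its covariant symbol σ_k(z) = (A_k K^ψ_z)(z)/K^ψ_z(z) satisfies σ_k(βz)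
= χ(β)σ_k(z) for any operator, and unfolding the Γ_∞-periodised Bergman seed gives σ_k =
κ_k·(Berezin transform of φ_a) + off-diagonal Γ₀(L)-terms → κ_k φ_a pointwise at non-elliptic z as k
→ ∞ (BerezinLocalization); continuity finishes. [deps: BerezinLocalization] [difficulty: XL] -/
@[route_item "route-Langlands-HolomorphicShadow", crux]
def ShadowConverse : Prop :=
  let K0 : ℝ → ℝ := fun x => ∫ t in Set.Ioi (0 : ℝ), Real.exp (-(x * Real.cosh t)); let maass : (ℕ → ℂ) → ℂ → UpperHalfPlane → ℂ := fun a ε z => ∑' n : ℕ, a (n + 1) * ((Real.sqrt z.im * K0 (2 * Real.pi * ((n : ℝ) + 1) * z.im) : ℝ) : ℂ) * (Complex.exp (2 * Real.pi * Complex.I * ((n : ℂ) + 1) * (z.re : ℂ)) + ε * Complex.exp (-(2 * Real.pi * Complex.I * ((n : ℂ) + 1) * (z.re : ℂ)))); let IsCusp : ℕ → ℕ → (ℤ → ℂ) → (UpperHalfPlane → ℂ) → (ℕ → ℂ) → Prop := fun k L ω g b => (∀ z : UpperHalfPlane, HasSum (fun m : ℕ => b (m + 1) * Complex.exp (2 *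 Real.pi * Complex.I * ((m : ℂ) + 1) * (z : ℂ))) (g z)) ∧ MDifferentiable (modelWithCornersSelf ℂ ℂ) (modelWithCornersSelf ℂ ℂ) g ∧ (∀ γ ∈ CongruenceSubgroup.Gamma0 L, ∀ z : UpperHalfPlane, g (γ • z) = ω ((γ : Matrix (Fin 2) (Fin 2) ℤ) 1 1) * ((((γ : Matrix (Fin 2) (Fin 2) ℤ) 1 0 : ℤ) : ℂ) * (z : ℂ) + (((γ : Matrix (Fin 2) (Fin 2) ℤ) 1 1 : ℤ) : ℂ)) ^ k * g z) ∧ ∃ C : ℝ, ∀ z : UpperHalfPlane, z.im ^ ((k : ℝ) / 2) * ‖g z‖ ≤ C; let Ik : ℕ → ℕ → ℕ → ℝ := fun k m m' => ∫ y in Set.Ioi (0 : ℝ), y ^ ((k : ℝ) - 3 / 2) * K0 (2 * Real.pi * |(m : ℝ) - (m' : ℝ)| * y) * Real.exp (-(2 * Real.pi * ((m : ℝ) + (m' : ℝ)) * y)); let term : (ℕ → ℂ) → ℂ → ℕ → (ℕ → ℂ) → ℕ → ℕ → ℂ := fun a ε k b m m' => if m' = 0 ∨ m' = m then 0 else (if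 m' < m then a (m - m') else ε * a (m' - m)) * b m' * ((Ik k m m' : ℝ) : ℂ); let coeff : (ℕ → ℂ) → ℂ → ℕ → (ℕ → ℂ) → ℕ → ℂ := fun a ε k b m => (((4 * Real.pi * (m : ℝ)) ^ (k - 1) / Real.Gamma ((k : ℝ) - 1) : ℝ) : ℂ) * ∑' m' : ℕ, term a ε k b m m'; let shadow : (ℕ → ℂ) → ℂ → ℕ → (ℕ → ℂ) → UpperHalfPlane → ℂ := fun a ε k b z => ∑' m : ℕ, coeff a ε k b (m + 1) * Complex.exp (2 * Real.pi * Complex.I * ((m : ℂ) + 1) * (z : ℂ)); let ShadowInS : (ℕ → ℂ) → ℂ → ℕ → (ℕ → ℂ) → ℕ → (ℤ → ℂ) → Prop := fun a ε k b L ω => (∀ m : ℕ, Summable (term a ε k b m)) ∧ IsCusp k L ω (shadow a ε k b) (coeff a ε k b); ∀ (N L : ℕ) (χ : DirichletCharacter ℂ N) (ψ : DirichletCharacter ℂ L) (ε : ℂ) (a : ℕ → ℂ) (k₀ : ℕ), 0 < N → N ∣ L → 0 < L → (ε = 1 ∨ ε = -1) → (∃ C A : ℝ, ∀ n : ℕ,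 ‖a n‖ ≤ C * ((n : ℝ) + 1) ^ A) → (∀ k : ℕ, k₀ ≤ k → ∀ (b : ℕ → ℂ) (g : UpperHalfPlane → ℂ), IsCusp k L (fun d : ℤ => ψ (d : ZMod L)) g b → ShadowInS a ε k b L (fun d : ℤ => χ (d : ZMod N) * ψ (d : ZMod L))) → (∀ γ ∈ CongruenceSubgroup.Gamma0 L, ∀ z : UpperHalfPlane, maass a ε (γ • z) = χ ((((γ : Matrix (Fin 2) (Fin 2) ℤ) 1 1 : ℤ) : ZMod N)) * maass a ε z)

/-- item stmt-Langlands-11631 · crux · rank 4 · open · by planner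
why it might fail: One test vector per weight: at fixed k the strip projection has infinite-dimensional kernel and a single g = Δ^j gives no reproducing-kernel/covariant-symbol argument; completeness of {Δ^j} in the weight aspect is a Müntz-type problem; a sparse or level-N′ a passing every Δ^j test refutes it.
sources: Sturm1980, Radulescu1998, GrossZagier1986, Iwaniec2002
[crux] SINGLE-FAMILY (Δ-TOWER) CONVERSE — the completeness question behind the finite test (card
'Fastest refutation'). N ≥ 1, χ even mod N, ε = ±1, a polynomially bounded: if for every j ≥ 1 the
shadow of (a, ε) against g = Δ^j (weight 12j, level N, trivial ψ) converges and lies in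
S_(12j)(Γ₀(N), χ), then φ_(a,ε) is Γ₀(N)-automorphic with character χ. Not on the `closes` path;
TRUE makes strong Artin for each even ρ equivalent to the countable explicit family of linear
identities H_(ρ,Δ^j) ∈ S_(12j)(N, det ρ) that the calibrated kit protocol (j002740) tests; FALSE
calibrates how many (k, g) a test needs. [deps: ShadowConverse] [difficulty: L] -/
@[route_item "route-Langlands-HolomorphicShadow"]
def DeltaTowerConverse : Prop :=
  let K0 : ℝ → ℝ := fun x => ∫ t in Set.Ioi (0 : ℝ), Real.exp (-(x * Real.cosh t)); let maass : (ℕ → ℂ) → ℂ → UpperHalfPlane → ℂ := fun a ε z => ∑' n : ℕ, a (n + 1) * ((Real.sqrt z.im * K0 (2 * Real.pi * ((n : ℝ) + 1) * z.im) : ℝ) : ℂ) * (Complex.exp (2 * Real.pi * Complex.I * ((n : ℂ) + 1) * (z.re : ℂ)) + ε * Complex.exp (-(2 * Real.pi * Complex.I * ((n : ℂ) + 1) * (z.re : ℂ)))); let IsCusp : ℕ → ℕ → (ℤ → ℂ) → (UpperHalfPlane → ℂ) → (ℕ → ℂ) → Prop := fun k L ω g b => (∀ z : UpperHalfPlane,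 HasSum (fun m : ℕ => b (m + 1) * Complex.exp (2 * Real.pi * Complex.I * ((m : ℂ) + 1) * (z : ℂ))) (g z)) ∧ MDifferentiable (modelWithCornersSelf ℂ ℂ) (modelWithCornersSelf ℂ ℂ) g ∧ (∀ γ ∈ CongruenceSubgroup.Gamma0 L, ∀ z : UpperHalfPlane, g (γ • z) = ω ((γ : Matrix (Fin 2) (Fin 2) ℤ) 1 1) * ((((γ : Matrix (Fin 2) (Fin 2) ℤ) 1 0 : ℤ) : ℂ) * (z : ℂ) + (((γ : Matrix (Fin 2) (Fin 2) ℤ) 1 1 : ℤ) : ℂ)) ^ k * g z) ∧ ∃ C : ℝ, ∀ z : UpperHalfPlane, z.im ^ ((k : ℝ) / 2) * ‖g z‖ ≤ C; let Ik : ℕ → ℕ → ℕ → ℝ := fun k m m' => ∫ y in Set.Ioi (0 : ℝ), y ^ ((k : ℝ) - 3 / 2) * K0 (2 * Real.pi * |(m : ℝ) - (m' : ℝ)| * y) * Real.exp (-(2 * Real.pi * ((m : ℝ) + (m' : ℝ)) * y)); let term : (ℕ → ℂ) → ℂ → ℕ → (ℕ → ℂ) → ℕ → ℕ → ℂ :=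 fun a ε k b m m' => if m' = 0 ∨ m' = m then 0 else (if m' < m then a (m - m') else ε * a (m' - m)) * b m' * ((Ik k m m' : ℝ) : ℂ); let coeff : (ℕ → ℂ) → ℂ → ℕ → (ℕ → ℂ) → ℕ → ℂ := fun a ε k b m => (((4 * Real.pi * (m : ℝ)) ^ (k - 1) / Real.Gamma ((k : ℝ) - 1) : ℝ) : ℂ) * ∑' m' : ℕ, term a ε k b m m'; let shadow : (ℕ → ℂ) → ℂ → ℕ → (ℕ → ℂ) → UpperHalfPlane → ℂ := fun a ε k b z => ∑' m : ℕ, coeff a ε k b (m + 1) * Complex.exp (2 * Real.pi * Complex.I * ((m : ℂ) + 1) * (z : ℂ)); let ShadowInS : (ℕ → ℂ) → ℂ → ℕ → (ℕ → ℂ) → ℕ → (ℤ → ℂ) → Prop := fun a ε k b L ω => (∀ m : ℕ, Summable (term a ε k b m)) ∧ IsCusp k L ω (shadow a ε k b) (coeff a ε k b); ∀ (N : ℕ) (χ : DirichletCharacter ℂ N) (ε : ℂ) (a : ℕ → ℂ), 0 < N → χ (-1) = 1 → (ε = 1 ∨ ε = -1) → (∃ C A : ℝ, ∀ n : ℕ,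 ‖a n‖ ≤ C * ((n : ℝ) + 1) ^ A) → (∀ (j : ℕ) (b : ℕ → ℂ), 1 ≤ j → IsCusp (12 * j) N (fun _ : ℤ => (1 : ℂ)) (fun z : UpperHalfPlane => ModularForm.discriminant z ^ j) b → ShadowInS a ε (12 * j) b N (fun d : ℤ => χ (d : ZMod N))) → (∀ γ ∈ CongruenceSubgroup.Gamma0 N, ∀ z : UpperHalfPlane, maass a ε (γ • z) = χ ((((γ : Matrix (Fin 2) (Fin 2) ℤ) 1 1 : ℤ) : ZMod N)) * maass a ε z)

-- earlier SectorComplement (stmt-Langlands-14152, replaced 2026-08-16T04:07:57Z -> stmt-Langlands-14623): retired by None — EvenStrongArtinSC → _root_.Langlands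
/-- item stmt-Langlands-14623 · crux · rank 5 · open · by planner
why it might fail: It is Langlands minus the even-Maass slice: false iff every admissible even Artin datum has an automorphic Maass lift while GL_n reciprocity fails elsewhere (irregular weight or non-CM F for (B), (A) off Shimura varieties, ∃𝓡 unrealizable for the placeholder p-adic Hodge data).
sources: BuzzardGeeLMS2014, FontaineMazurGeometric1995, TaylorGaloisRepresentations2004, Calegari2023, BarnetlambEtAl2014, KhareWintenberger2009
[crux] SECTOR COMPLEMENT — the junction crux OWNED by this route (rank 5; D-0018 NOTE 3: a route
encompasses the entire summit, so the complementary sector of its bridge is one of its ranked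
cruxes), rev 7 stated over the OUTPUT OF X so that the deciding theorem is crux-only: `Langlands` —
global Langlands reciprocity for GL_n over every number field, both directions (A) and (B), every n
≥ 1, local–global compatibility at every finite place, one ReciprocityData per field (the summit
verbatim) — GIVEN that for every irreducible σ : Γ_ℚ → GL₂(ℂ) and every admissible Artin datum (N >
0; χ a Dirichlet character mod N; ε = ±1 with σ(c) = ε·1 at every complex conjugation; a : ℕ → ℂ
with ‖a_n‖ ≤ C(n+1)^A, Euler-pinned to σ away from N: a₁ = 1, multiplicative, a(p^(j+1)) = 0 for p ∣
N, Frobenius recursion with charpoly σ(Frob_p) = X² − a_pX + χ(p) for p ∤ N) there is a level L > 0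
with N ∣ L such that the Maass lift φ_(a,ε)(z) = Σ a_n √y K₀(2πny)(e(nx) + ε e(−nx)) satisfies φ(γz)
= χ(d_γ) φ(z) on Γ₀(L) (vacuous for odd σ, whose σ(c) is never scalar; for even σ this is classical
even strong Artin in Maass-form form — exactly what ShadowModularity + ShadowConverse deliver).
Implied by `Langl -/
@[route_item "route-Langlands-HolomorphicShadow", crux]
def SectorComplement : Prop :=
  let K0 : ℝ → ℝ := fun x => ∫ t in Set.Ioi (0 : ℝ), Real.exp (-(x * Real.cosh t)); let maass : (ℕ → ℂ) → ℂ → UpperHalfPlane → ℂ := fun a ε z => ∑' n : ℕ, a (n + 1) * ((Real.sqrt z.im * K0 (2 * Real.pi * ((n : ℝ) + 1) * z.im) : ℝ) : ℂ) * (Complex.exp (2 * Real.pi * Complex.I * ((n : ℂ) + 1) * (z.re : ℂ)) + ε * Complex.exp (-(2 * Real.pi * Complex.I * ((n : ℂ) + 1) * (z.re : ℂ)))); let EulerPin : Literature.NumberTheory.GaloisRepresentations.FramedGaloisRep ℚ ℂ 2 → (N : ℕ) → DirichletCharacter ℂ N → (ℕ → ℂ) → Prop := fun σ N χ a => a 1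 = 1 ∧ (∀ m n : ℕ, Nat.Coprime m n → a (m * n) = a m * a n) ∧ (∀ p : ℕ, p.Prime → p ∣ N → ∀ j : ℕ, a (p ^ (j + 1)) = 0) ∧ (∀ p : ℕ, p.Prime → ¬ p ∣ N → (∀ j : ℕ, a (p ^ (j + 2)) = a p * a (p ^ (j + 1)) - χ (p : ZMod N) * a (p ^ j)) ∧ ∀ v : IsDedekindDomain.HeightOneSpectrum (NumberField.RingOfIntegers ℚ), (p : NumberField.RingOfIntegers ℚ) ∈ v.asIdeal → Literature.NumberTheory.GaloisRepresentations.FramedGaloisRep.IsUnramifiedAt v σ ∧ Literature.NumberTheory.GaloisRepresentations.FramedGaloisRep.HasFrobCharpolyAt v (Polynomial.X ^ 2 - Polynomial.C (a p) * Polynomial.X + Polynomial.C (χ (p : ZMod N))) σ); let ParityPin : Literature.NumberTheory.GaloisRepresentations.FramedGaloisRep ℚ ℂ 2 → ℂ → Prop := fun σ ε => ∀ (φ : ℚ →+* ℝ) (c : Field.absoluteGaloisGroup ℚ), Literature.NumberTheory.GaloisRepresentations.IsComplexConjugation φ c → ((σ c : GL (Fin 2) ℂ) : Matrix (Fin 2)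 (Fin 2) ℂ) = ε • (1 : Matrix (Fin 2) (Fin 2) ℂ); (∀ σ : Literature.NumberTheory.GaloisRepresentations.FramedGaloisRep ℚ ℂ 2, σ.toGaloisRep.IsIrreducible → ∀ (N : ℕ) (χ : DirichletCharacter ℂ N) (ε : ℂ) (a : ℕ → ℂ), 0 < N → (ε = 1 ∨ ε = -1) → ParityPin σ ε → (∃ C A : ℝ, ∀ n : ℕ, ‖a n‖ ≤ C * ((n : ℝ) + 1) ^ A) → EulerPin σ N χ a → ∃ L : ℕ, 0 < L ∧ N ∣ L ∧ ∀ γ ∈ CongruenceSubgroup.Gamma0 L, ∀ z : UpperHalfPlane, maass a ε (γ • z) = χ ((((γ : Matrix (Fin 2) (Fin 2) ℤ) 1 1 : ℤ) : ZMod N)) * maass a ε z) → _root_.Langlands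

/-- item stmt-Langlands-19093 · crux · rank 6 · open · by planner
why it might fail: Formalization debt, not mathematics (JS II Prop. 3.6 is a theorem): false AS TYPED only by a normalisation slip in the inlined text (q_w^(1−s₀) vs q_w^(s₀−1), unitary normalisation, α vs β⁻¹); ranks ≤ 2 of this exact text are proved in tree.
sources: JacquetShalikaAJM1981II, ArthurClozelAMS120, JacquetShalikaAJM1981, ShahidiAJM1981, HumphriesJo2024, CogdellAnalyticTheory2004
[crux] ARTHUR–CLOZEL (2.3) FOR BOREL–JACQUET DATA — PROMOTED LITERATURE INPUT of the junction's line
(route-choice 2026-08-17, unit rchoice-Summits-Langlands-Langlands-Cr-16a26670: the birth skeleton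
Cruxes/SectorComplement/Lines/birth.lean of SectorComplement (stmt-Langlands-14623) consumed the
named fact Literature.NumberTheory.Automorphic.JacquetShalika1981_partialPairL_pole_repData as its
stub stub_pairLPoleJS; that fact is judged XL-apex — too large for one prover seat, and non-crux
Literature facts are not split — so it is promoted to an explicit crux of this route and the line is
rewired to this decl BY NAME). STATEMENT (Jacquet–Shalika II Prop. 3.6 = Arthur–Clozel Ch. 3 §2
(2.3), p. 171, in the Borel–Jacquet model): for cuspidal π, π′ on GL_n(𝔸_F) (n ≥ 1, data
CuspidalAutomorphicRepData, arbitrary central characters) there is a finite S₀ such that for every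
finite S ⊇ S₀, all Satake families α, β of π, π′ off S in unitary normalisation (‖∏α_w‖ = ‖∏β_w‖ =
1) and every s₀ on Re s = 1 IN X (q_w^(1−s₀)·α_w = β_w⁻¹ as multisets for almost all w: the
Hecke-matrix form of π ⊗ |·|^(s₀−1) ≅ σ̃), the limit of (s − s₀)·L^S(s, α × β) as s → s₀ with Re s >
1 exists and is NON-ZERO, wher -/
@[route_item "route-Langlands-HolomorphicShadow"]
def PairLPoleJS : Prop :=
  ∀ (n : ℕ) (F : Type) [Field F] [NumberField F] (hF : Literature.NumberTheory.Automorphic.isCompact_glFiniteIntegralLevel n F), 0 < n → ∀ (π π' : Literature.NumberTheory.Automorphic.CuspidalAutomorphicRepData n F hF), ∃ S₀ : Set (IsDedekindDomain.HeightOneSpectrum (NumberField.RingOfIntegers F)), S₀.Finite ∧ ∀ {S : Set (IsDedekindDomain.HeightOneSpectrum (NumberField.RingOfIntegers F))}, S.Finite → S₀ ⊆ S → ∀ {α β : IsDedekindDomain.HeightOneSpectrum (NumberField.RingOfIntegers F) → Multiset ℂ}, (∀ w ∉ S, π.1.HasSatakeParamAt w (α w)) → (∀ w ∉ S, π'.1.HasSatakeParamAt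 w (β w)) → (∀ w ∉ S, ‖(α w).prod‖ = 1) → (∀ w ∉ S, ‖(β w).prod‖ = 1) → ∀ {s₀ : ℂ}, s₀.re = 1 → (∀ᶠ w in cofinite, (α w).map ((((w.residueCard : ℂ) ^ (1 - s₀))) * ·) = (β w).map (·⁻¹)) → ∃ c : ℂ, c ≠ 0 ∧ Tendsto (fun s : ℂ => (s - s₀) * ∏' w : {w : IsDedekindDomain.HeightOneSpectrum (NumberField.RingOfIntegers F) // w ∉ S}, ((Literature.NumberTheory.Automorphic.satakePairPolynomial (α w.1) (β w.1)).eval ((w.1.residueCard : ℂ) ^ (-s)))⁻¹) (𝓝[{s : ℂ | 1 < s.re}] s₀) (𝓝 c)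

/-- item stmt-Langlands-13622 · crux · rank 7 · open · by planner
why it might fail: Formalization debt, not mathematics (JS II Prop. 3.6 off X + Shahidi non-vanishing): false AS TYPED only by a normalisation slip in the inlined text (q_w^(1−s₀) vs q_w^(s₀−1), unitary normalisation, X-condition n = m ∧ α·q^(1−s₀) = β⁻¹ a.e.).
sources: JacquetShalikaAJM1981II, ArthurClozelAMS120, JacquetShalikaAJM1981, ShahidiAJM1981
[support] INPUT — Jacquet–Shalika 1981 / Arthur–Clozel Ch. 3 (2.2) for cuspidal Borel–Jacquet data
on GL_n × GL_m: off the X-condition (n = m and, a.e., β_w⁻¹ = q_w^{1−s₀}·α_w as multisets), assuming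
unitary central characters a.e. (‖∏ α_w‖ = ‖∏ β_w‖ = 1), the partial Rankin–Selberg product L^S(s, α
× β) = ∏'_{w ∉ S} ∏_{a,b} (1 − a b q_w^{−s})⁻¹ has a finite NON-ZERO limit at Re s₀ = 1 from Re s >
1. SAME TEXT as
`Literature.NumberTheory.Automorphic.JacquetShalika1981_partialPairL_boundary_repData` with
`partialPairL S α β` unfolded to its defining `tprod` over `satakePairPolynomial`
(RankinSelbergLocal, in the Statement's closure) and `SatakeFamily F` unfolded to `HeightOneSpectrum
(𝓞 F) → Multiset ℂ` — definitionally equal (delta/eta), closes by `exact`/`simpa [partialPairL]` the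
day the fact's `_holds` lands (it is reduced in tree to its L² leaves). CONE REPAIR 2026-08-15
(route-repair planner): no import of PairLFunctionPolesRepData (whose closure carried 383 modules /
~45 unproved facts into the cone). Rank 1 (renders before IrreducibleGL3CM). [difficulty: L] -/
@[route_item "route-Langlands-HolomorphicShadow"]
def PairLBoundaryJS : Prop :=
  ∀ (n m : ℕ) (F : Type) [Field F] [NumberField F] (hF : _) (hF' : _), 0 < n → 0 < m → ∀ (π : Literature.NumberTheory.Automorphic.CuspidalAutomorphicRepData n F hF) (π' : Literature.NumberTheory.Automorphic.CuspidalAutomorphicRepData m F hF'), ∃ S₀ : Set (IsDedekindDomain.HeightOneSpectrum (NumberField.RingOfIntegers F)), S₀.Finite ∧ ∀ {S : Set (IsDedekindDomain.HeightOneSpectrum (NumberField.RingOfIntegers F))}, S.Finite → S₀ ⊆ S → ∀ {α β : IsDedekindDomain.HeightOneSpectrum (NumberField.RingOfIntegers F) → Multiset ℂ}, (∀ w ∉ S, π.1.HasSatakeParamAt w (α w)) → (∀ w ∉ S, π'.1.HasSatakeParamAt w (β w)) → (∀ w ∉ S, ‖(α w).prod‖ = 1) → (∀ w ∉ S, ‖(β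 w).prod‖ = 1) → ∀ {s₀ : ℂ}, s₀.re = 1 → ¬ (n = m ∧ ∀ᶠ w in cofinite, (α w).map ((((w.residueCard : ℂ) ^ (1 - s₀))) * ·) = (β w).map (·⁻¹)) → ∃ c : ℂ, c ≠ 0 ∧ Tendsto (fun s : ℂ => ∏' w : {w : IsDedekindDomain.HeightOneSpectrum (NumberField.RingOfIntegers F) // w ∉ S}, ((Literature.NumberTheory.Automorphic.satakePairPolynomial (α w.1) (β w.1)).eval ((w.1.residueCard : ℂ) ^ (-s)))⁻¹) (𝓝[{s : ℂ | 1 < s.re}] s₀) (𝓝 c)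

/-- item stmt-Langlands-11634 · support · rank 9 · open · by planner
sources: Sturm1980, GrossZagier1986, Iwaniec2002
[support] STURM FORWARD FOR THIS KERNEL (known: Sturm1980 Thm 1, p. 436 — F ∈ 𝔊(k,N,χ,b): C^∞, F(γz)
= χ(d) j(k,γ,z) F(z) on Γ₀(N), |F| ≤ C(y^a + y^(−b)), k > 2, b < k − 1 ⟹ h = Σ c(n)e(nz) ∈ S(k,N,χ)
with c(n) = (4πn)^(k−1)Γ(k−1)^(−1)∫_0^∞ a(n,y)e^(−2πny)y^(k−2)dy and ⟨g,F⟩ = ⟨g,h⟩; here F =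
φ_(a,ε)·g has b = k/2; GrossZagier1986 §IV.5 (5.1)–(5.2) for the weight-2 correction we avoid). If
φ_(a,ε) (‖a_n‖ ≤ C(n+1)^A, ε = ±1) is Γ₀(N)-automorphic with character χ and bounded, then for every
k ≥ 4 with k > 2A + 4, every L ≥ 1 with N ∣ L, ψ mod L and g ∈ S_k(Γ₀(L), ψ), the shadow converges
and lies in S_k(Γ₀(L), χψ): it IS π_hol(φ_(a,ε) g) (unfold ⟨φ g, P_m⟩, Fubini by absolute
convergence, coefficient formula c_m = (4πm)^(k−1)/Γ(k−1) ∫ F_m(y) e^(−2πmy) y^(k−2) dy). Not on the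
`closes` path; filing it makes a certified non-modular shadow of a(ρ) a refutation of the level-N
Maass newform predicted for ρ, i.e. evidence against EvenStrongArtin. [difficulty: L] -/
@[route_item "route-Langlands-HolomorphicShadow"]
def ShadowNecessity : Prop :=
  let K0 : ℝ → ℝ := fun x => ∫ t in Set.Ioi (0 : ℝ), Real.exp (-(x * Real.cosh t)); let maass : (ℕ → ℂ) → ℂ → UpperHalfPlane → ℂ := fun a ε z => ∑' n : ℕ, a (n + 1) * ((Real.sqrt z.im * K0 (2 * Real.pi * ((n : ℝ) + 1) * z.im) : ℝ) : ℂ) * (Complex.exp (2 * Real.pi * Complex.I * ((n : ℂ) + 1) * (z.re : ℂ)) + ε * Complex.exp (-(2 * Real.pi * Complex.I * ((n : ℂ) + 1) * (z.re : ℂ)))); let IsCusp : ℕ → ℕ → (ℤ → ℂ) → (UpperHalfPlane → ℂ) → (ℕ → ℂ) → Prop := fun k L ω g b => (∀ z : UpperHalfPlane, HasSum (fun m : ℕ => b (m + 1) * Complex.exp (2 * Real.pi * Complex.I * ((m : ℂ) + 1) * (z : ℂ))) (g z)) ∧ MDifferentiable (modelWithCornersSelf ℂ ℂ) (modelWithCornersSelf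 ℂ ℂ) g ∧ (∀ γ ∈ CongruenceSubgroup.Gamma0 L, ∀ z : UpperHalfPlane, g (γ • z) = ω ((γ : Matrix (Fin 2) (Fin 2) ℤ) 1 1) * ((((γ : Matrix (Fin 2) (Fin 2) ℤ) 1 0 : ℤ) : ℂ) * (z : ℂ) + (((γ : Matrix (Fin 2) (Fin 2) ℤ) 1 1 : ℤ) : ℂ)) ^ k * g z) ∧ ∃ C : ℝ, ∀ z : UpperHalfPlane, z.im ^ ((k : ℝ) / 2) * ‖g z‖ ≤ C; let Ik : ℕ → ℕ → ℕ → ℝ := fun k m m' => ∫ y in Set.Ioi (0 : ℝ), y ^ ((k : ℝ) - 3 / 2) * K0 (2 * Real.pi * |(m : ℝ) - (m' : ℝ)| * y) * Real.exp (-(2 * Real.pi * ((m : ℝ) + (m' : ℝ)) * y)); let term : (ℕ → ℂ) → ℂ → ℕ → (ℕ → ℂ) → ℕ → ℕ → ℂ := fun a ε k b m m' => if m' = 0 ∨ m' = m then 0 else (if m' < m then a (m - m') else ε * a (m' - m)) * b m' * ((Ik k m m' : ℝ) : ℂ); let coeff : (ℕ → ℂ) → ℂ → ℕ → (ℕ →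 ℂ) → ℕ → ℂ := fun a ε k b m => (((4 * Real.pi * (m : ℝ)) ^ (k - 1) / Real.Gamma ((k : ℝ) - 1) : ℝ) : ℂ) * ∑' m' : ℕ, term a ε k b m m'; let shadow : (ℕ → ℂ) → ℂ → ℕ → (ℕ → ℂ) → UpperHalfPlane → ℂ := fun a ε k b z => ∑' m : ℕ, coeff a ε k b (m + 1) * Complex.exp (2 * Real.pi * Complex.I * ((m : ℂ) + 1) * (z : ℂ)); let ShadowInS : (ℕ → ℂ) → ℂ → ℕ → (ℕ → ℂ) → ℕ → (ℤ → ℂ) → Prop := fun a ε k b L ω => (∀ m : ℕ, Summable (term a ε k b m)) ∧ IsCusp k L ω (shadow a ε k b) (coeff a ε k b); ∀ (N L : ℕ) (χ : DirichletCharacter ℂ N) (ψ : DirichletCharacter ℂ L) (ε : ℂ) (a : ℕ → ℂ) (C A : ℝ), 0 < N → N ∣ L → 0 < L → (ε = 1 ∨ ε = -1) → (∀ n : ℕ, ‖a n‖ ≤ C * ((n : ℝ) + 1) ^ A) → (∀ γ ∈ CongruenceSubgroup.Gamma0 N, ∀ z : UpperHalfPlane, maass a ε (γ • z) = χ ((((γ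 : Matrix (Fin 2) (Fin 2) ℤ) 1 1 : ℤ) : ZMod N)) * maass a ε z) → (∃ B : ℝ, ∀ z : UpperHalfPlane, ‖maass a ε z‖ ≤ B) → ∀ k : ℕ, 4 ≤ k → 2 * A + 4 < (k : ℝ) → ∀ (b : ℕ → ℂ) (g : UpperHalfPlane → ℂ), IsCusp k L (fun d : ℤ => ψ (d : ZMod L)) g b → ShadowInS a ε k b L (fun d : ℤ => χ (d : ZMod N) * ψ (d : ZMod L))

/-- item stmt-Langlands-11635 · support · rank 9 · open · by planner
sources: Radulescu1998, Iwaniec2002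
[support] BEREZIN TRANSFORM → IDENTITY ON POLYNOMIALLY BOUNDED CONTINUOUS FUNCTIONS (provable now
over Mathlib's measure and metric on ℍ; Radulescu1998 Introduction for bounded symbols): for φ
continuous with ‖φ(z)‖ ≤ C(y^A + y^(−A)) and every z₀, (k−1)/(4π) ∫_ℍ cosh(d(z,z₀)/2)^(−2k) φ(z)
dμ(z) → φ(z₀) as k → ∞ (the kernel has total mass 4π/(k−1) and concentrates in balls of radius
k^(−1/2); the tail beats e^(A d)). The analytic heart of ShadowConverse (its foreseen layer-2
child). [difficulty: provable-now] -/
@[route_item "route-Langlands-HolomorphicShadow"]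
def BerezinLocalization : Prop :=
  ∀ (φ : UpperHalfPlane → ℂ) (C A : ℝ), Continuous φ → (∀ z : UpperHalfPlane, ‖φ z‖ ≤ C * (z.im ^ A + z.im ^ (-A))) → ∀ z₀ : UpperHalfPlane, Filter.Tendsto (fun k : ℕ => ((((k : ℝ) - 1) / (4 * Real.pi) : ℝ) : ℂ) * ∫ z : UpperHalfPlane, (((Real.cosh (dist z z₀ / 2)) ^ (-(2 * (k : ℝ))) : ℝ) : ℂ) * φ z) Filter.atTop (nhds (φ z₀))

-- earlier MaassEigenformStrongArtin (stmt-Langlands-11632, replaced 2026-08-15T19:03:55Z -> stmt-Langlands-13895): retired by None — let K0 : ℝ → ℝ := fun x => ∫ t in Set.Ioi (0 : ℝ), Real.exp (-(x * Real.cosh t)); let maass : (ℕ → ℂ) → ℂ → UpperHalfPlane → ℂ := fun a ε z => ∑' n : ℕ, a (n + 1) * ((Real.sqrt z.im * K0 (2 * Real.pi * ((n : ℝ) + 1) * z.im) : ℝ) : ℂ) * (Complex.exp (2 * Real.pi * Compl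
/-- item stmt-Langlands-13895 · support · rank 9 · open · by planner
sources: Gelbart1975, Bump1997, Iwaniec2002, DiamondShurman2005
[support] MAASS-EIGENFORM DICTIONARY (hand-off, known in substance: Gelbart1975 §3, Bump1997
§3.2/§3.6, Iwaniec2002 for Maass forms with nebentypus and their Hecke operators; rev 1 typed over
the Statement cone). For irreducible σ : Γ_ℚ → GL₂(ℂ), N ∣ L, N, L ≥ 1, ε = ±1, a polynomially
bounded and Euler-pinned to σ away from N (a₁ = 1, multiplicative, a(p^(j+1)) = 0 for p ∣ N,
Frobenius recursion + charpoly σ(Frob_p) = X² − a_pX + χ(p) for p ∤ N): if φ_(a,ε)(z) = Σ a_n √y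
K₀(2πny)(e(nx) + ε e(−nx)) satisfies φ(γz) = χ(d_γ)φ(z) on Γ₀(L), then σ has a cuspidal P with
Satake–Frobenius matching at almost all places (the EvenStrongArtinSC conclusion). Content: φ ≠ 0
(a₁ = 1), moderate growth, Δφ = −φ/4 termwise; multiplicativity + the degree-2 recursion at p ∤ L
make φ a T_p-eigenfunction with eigenvalue a_p = tr σ(Frob_p) and ⟨p⟩ = χ(p) = det σ(Frob_p); an
Eisenstein component would force tr σ(Frob_p) = χ₁(p)+χ₂(p) a.e., i.e. σ ≅ χ₁ ⊕ χ₂ (Chebotarev +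
Brauer–Nesbitt), contradicting irreducibility, so φ is cuspidal and an irreducible constituent π of
the representation it generates has π_p unramified with Satake polynomial X² − a_pX + χ(p) for p ∤
L. Replaces rev 0 (LSeries a = artinLFu -/
@[route_item "route-Langlands-HolomorphicShadow"]
def MaassEigenformStrongArtin : Prop :=
  let K0 : ℝ → ℝ := fun x => ∫ t in Set.Ioi (0 : ℝ), Real.exp (-(x * Real.cosh t)); let maass : (ℕ → ℂ) → ℂ → UpperHalfPlane → ℂ := fun a ε z => ∑' n : ℕ, a (n + 1) * ((Real.sqrt z.im * K0 (2 * Real.pi * ((n : ℝ) + 1) * z.im) : ℝ) : ℂ) * (Complex.exp (2 * Real.pi * Complex.I * ((n : ℂ) + 1) * (z.re : ℂ)) + ε * Complex.exp (-(2 * Real.pi * Complex.I * ((n : ℂ) + 1) * (z.re : ℂ)))); let EulerPin : Literature.NumberTheory.GaloisRepresentations.FramedGaloisRep ℚ ℂ 2 → (N : ℕ) → DirichletCharacter ℂ N → (ℕ → ℂ) → Prop := fun σ N χ a => a 1 = 1 ∧ (∀ m n : ℕ, Nat.Coprime m n → a (m * n) = a m * a n) ∧ (∀ p : ℕ, p.Prime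 → p ∣ N → ∀ j : ℕ, a (p ^ (j + 1)) = 0) ∧ (∀ p : ℕ, p.Prime → ¬ p ∣ N → (∀ j : ℕ, a (p ^ (j + 2)) = a p * a (p ^ (j + 1)) - χ (p : ZMod N) * a (p ^ j)) ∧ ∀ v : IsDedekindDomain.HeightOneSpectrum (NumberField.RingOfIntegers ℚ), (p : NumberField.RingOfIntegers ℚ) ∈ v.asIdeal → Literature.NumberTheory.GaloisRepresentations.FramedGaloisRep.IsUnramifiedAt v σ ∧ Literature.NumberTheory.GaloisRepresentations.FramedGaloisRep.HasFrobCharpolyAt v (Polynomial.X ^ 2 - Polynomial.C (a p) * Polynomial.X + Polynomial.C (χ (p : ZMod N))) σ); ∀ σ : Literature.NumberTheory.GaloisRepresentations.FramedGaloisRep ℚ ℂ 2, σ.toGaloisRep.IsIrreducible → ∀ (N L : ℕ) (χ : DirichletCharacter ℂ N) (ε : ℂ) (a : ℕ → ℂ), 0 < N → N ∣ L → 0 < L → (ε = 1 ∨ ε = -1) → (∃ C A : ℝ, ∀ n : ℕ, ‖a n‖ ≤ C * ((n : ℝ) + 1) ^ A) → EulerPin σ N χ a → (∀ γ ∈ CongruenceSubgroup.Gamma0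 L, ∀ z : UpperHalfPlane, maass a ε (γ • z) = χ ((((γ : Matrix (Fin 2) (Fin 2) ℤ) 1 1 : ℤ) : ZMod N)) * maass a ε z) → ∃ (hcpt : Literature.NumberTheory.Automorphic.isCompact_glFiniteIntegralLevel 2 ℚ) (P : Literature.NumberTheory.Automorphic.CuspidalAutomorphicRepData 2 ℚ hcpt), (∀ᶠ v : IsDedekindDomain.HeightOneSpectrum (NumberField.RingOfIntegers ℚ) in Filter.cofinite, ∃ α : Multiset ℂ, Literature.NumberTheory.Automorphic.AutomorphicRepData.HasSatakeParamAt P.1 v α ∧ Literature.NumberTheory.GaloisRepresentations.FramedGaloisRep.IsUnramifiedAt v σ ∧ Literature.NumberTheory.GaloisRepresentations.FramedGaloisRep.HasFrobCharpolyAt v (Literature.NumberTheory.Automorphic.satakePolynomial α) σ)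

-- earlier EvenArtinShadowData (stmt-Langlands-11633, replaced 2026-08-15T19:03:55Z -> stmt-Langlands-13896): retired by None — ∀ σ : Literature.NumberTheory.GaloisRepresentations.FramedArtinRep ℚ 2, σ.toGaloisRep.IsIrreducible → (∀ (φ : ℚ →+* ℝ) (c : Field.absoluteGaloisGroup ℚ), Literature.NumberTheory.GaloisRepresentations.IsComplexConjugation φ c → Matrix.GeneralLinearGroup.det (σ c) = 1) → ∃ (N 
/-- item stmt-Langlands-13896 · support · rank 9 · closed · proved by Summit.Langlands.Langlands.Theorems.HolomorphicShadow.EvenArtinData.evenArtinShadowData (prover) · by planner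
sources: SerreAbelianLadic1968, Martinet1977, DiamondShurman2005
[support] ARTIN DATA OF AN EVEN ρ (routine Artin formalism, rev 1 typed over the Statement cone;
supplies the tuple the cruxes quantify over): for irreducible even σ : Γ_ℚ → GL₂(ℂ) there are N > 0,
a Dirichlet character χ mod N, ε ∈ {1, −1} and a : ℕ → ℂ with σ(c) = ε·1 for every complex
conjugation c (an involution of determinant 1 in GL₂(ℂ) is ±1), ‖a_n‖ ≤ C(n+1)^A, and the Euler pin
(a₁ = 1, multiplicative, a(p^(j+1)) = 0 for p ∣ N; for p ∤ N: σ unramified at p, charpoly σ(Frob_p)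
= X² − a_p X + χ(p), a(p^(j+2)) = a_p a(p^(j+1)) − χ(p) a(p^j)). Witness from PROVED tree theorems
(a Theorems file may import them; the cone guardrail concerns the route file only): finite image
(ArtinRep.finite_range_holds) ⇒ unramified outside a finite S (ArtinRep.isUnramifiedAE); det σ has
finite order ⇒ Kronecker–Weber (KroneckerWeber_holds, exists_dirichletCharacter_of_kroneckerWeber)
gives χ₀ mod M with χ₀(p) = det σ(Frob_p), p ∤ M; take N = M·Π_(p∈S) p, χ = χ₀ mod N, a
multiplicative from a(p^j) = 0 (p ∣ N) and the recursion seeded by a_p = tr σ(Frob_p)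
(hasFrobCharpolyAt_frobCharpoly_holds); eigenvalues are roots of unity so |a_n| ≤ d(n) ≤
2(n+1)^(1/2). Replaces rev 0 (N = artinConductorNat σ, -/
@[route_item "route-Langlands-HolomorphicShadow"]
def EvenArtinShadowData : Prop :=
  let EulerPin : Literature.NumberTheory.GaloisRepresentations.FramedGaloisRep ℚ ℂ 2 → (N : ℕ) → DirichletCharacter ℂ N → (ℕ → ℂ) → Prop := fun σ N χ a => a 1 = 1 ∧ (∀ m n : ℕ, Nat.Coprime m n → a (m * n) = a m * a n) ∧ (∀ p : ℕ, p.Prime → p ∣ N → ∀ j : ℕ, a (p ^ (j + 1)) = 0) ∧ (∀ p : ℕ, p.Prime → ¬ p ∣ N → (∀ j : ℕ, a (p ^ (j + 2)) = a p * a (p ^ (j + 1)) - χ (p : ZMod N) * a (p ^ j)) ∧ ∀ v : IsDedekindDomain.HeightOneSpectrum (NumberField.RingOfIntegers ℚ), (p : NumberField.RingOfIntegers ℚ) ∈ v.asIdeal → Literature.NumberTheory.GaloisRepresentations.FramedGaloisRep.IsUnramifiedAt v σ ∧ Literature.NumberTheory.GaloisRepresentations.FramedGaloisRep.HasFrobCharpolyAt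 v (Polynomial.X ^ 2 - Polynomial.C (a p) * Polynomial.X + Polynomial.C (χ (p : ZMod N))) σ); let ParityPin : Literature.NumberTheory.GaloisRepresentations.FramedGaloisRep ℚ ℂ 2 → ℂ → Prop := fun σ ε => ∀ (φ : ℚ →+* ℝ) (c : Field.absoluteGaloisGroup ℚ), Literature.NumberTheory.GaloisRepresentations.IsComplexConjugation φ c → ((σ c : GL (Fin 2) ℂ) : Matrix (Fin 2) (Fin 2) ℂ) = ε • (1 : Matrix (Fin 2) (Fin 2) ℂ); ∀ σ : Literature.NumberTheory.GaloisRepresentations.FramedGaloisRep ℚ ℂ 2, σ.toGaloisRep.IsIrreducible → (∀ (φ : ℚ →+* ℝ) (c : Field.absoluteGaloisGroup ℚ), Literature.NumberTheory.GaloisRepresentations.IsComplexConjugation φ c → Matrix.GeneralLinearGroup.det (σ c) = 1) → ∃ (N : ℕ) (χ : DirichletCharacter ℂ N) (ε : ℂ) (a : ℕ → ℂ), 0 < N ∧ (ε = 1 ∨ ε = -1) ∧ ParityPin σ ε ∧ (∃ C A : ℝ, ∀ n : ℕ, ‖a n‖ ≤ C * ((n : ℝ) + 1) ^ A) ∧ EulerPin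 σ N χ a

-- `EvenArtinShadowData` holds: proved by `Summit.Langlands.Langlands.Theorems.HolomorphicShadow.EvenArtinData.evenArtinShadowData` (its module imports this route file, so no `_holds` link can be stated here).

/-- item stmt-Langlands-14114 · support · rank 9 · closed · proved by Summit.Langlands.Langlands.Theorems.HolomorphicShadowEvenArtinFromShadows.evenArtinFromShadows (prover) · by planner
sources: Sturm1980, Radulescu1998
[support] SLICE GLUE (provable now, pure logic — the body of the deciding theorem `closes` up to its
last step; term `evenArtinFromShadows_holds` in the planner's Sketch.lean, rc 0, axioms
propext/Classical.choice/Quot.sound): X = ShadowModularity ∧ ShadowConverse together with the two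
dictionaries MaassEigenformStrongArtin and EvenArtinShadowData proves the target EvenStrongArtinSC
(even strong Artin over ℚ, a.e.-Satake form) BY NAME. Proof: fix σ irreducible and even;
EvenArtinShadowData gives (N, χ, ε, a); ShadowModularity gives a good level L₀ (N ∣ L₀) at which all
shadows (k ≥ 4, ψ = 1) are cusp forms of character χ; ShadowConverse at (N, L₀, χ, ψ = 1, k₀ = 4)
returns Γ₀(L₀)-automorphy of φ_(a,ε) with character χ; MaassEigenformStrongArtin turns it into the
cuspidal P. Filed at rev 5 (route-choice 2026-08-16) so that an item of the route concludes the
target by name (gate `route.target-unreachable`) now that the junction OffEvenArtinSC is stated over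
the target decl; `closes` = OffEvenArtinSC ∘ this. Any idle prover closes it with the Sketch term.
[deps: ShadowModularity, ShadowConverse, MaassEigenformStrongArtin, EvenArtinShadowData]
[difficulty: provable-now] -/
@[route_item "route-Langlands-HolomorphicShadow"]
def EvenArtinFromShadows : Prop :=
  ShadowModularity → ShadowConverse → MaassEigenformStrongArtin → EvenArtinShadowData → EvenStrongArtinSC

-- `EvenArtinFromShadows` holds: proved by `Summit.Langlands.Langlands.Theorems.HolomorphicShadowEvenArtinFromShadows.evenArtinFromShadows` (its module imports this route file, so no `_holds` link can be stated here).

-- earlier Assembly (stmt-Langlands-11636, replaced 2026-08-15T19:03:55Z -> stmt-Langlands-13897): retired by None — ShadowModularity → ShadowConverse → MaassEigenformStrongArtin → EvenArtinShadowData → OffEvenArtin → _root_.Langlands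
-- earlier Assembly (stmt-Langlands-13897, replaced 2026-08-16T03:04:51Z -> stmt-Langlands-14151): retired by None — ShadowModularity → ShadowConverse → MaassEigenformStrongArtin → EvenArtinShadowData → OffEvenArtinSC → _root_.Langlands
-- earlier Assembly (stmt-Langlands-14151, replaced 2026-08-16T04:14:39Z -> stmt-Langlands-14644): retired by None — ShadowModularity → ShadowConverse → MaassEigenformStrongArtin → EvenArtinShadowData → SectorComplement → _root_.Langlands
/-- item stmt-Langlands-14644 · assembly · rank 1 · closed · proved by Summit.Langlands.Langlands.Theorems.holomorphicShadow_assembly_proof (prover) · by planner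
sources: Sturm1980, Radulescu1998
[assembly] ShadowModularity → ShadowConverse → SectorComplement → Langlands — the deciding theorem
`closes` as a Prop (rev 8: crux-only; the junction crux SectorComplement is stated over the output
of X, so the two dictionary supports MaassEigenformStrongArtin / EvenArtinShadowData are no longer
antecedents — they serve the target chain EvenArtinFromShadows instead). Proved by the term of
`closes` (`assembly_holds` in the planner's Sketch.lean, lean check rc 0, axioms
propext/Classical.choice/Quot.sound); any idle prover closes it with `fun hSM hSC hC => closes hSM
hSC hC`. -/
@[route_item "route-Langlands-HolomorphicShadow"]
def Assembly : Prop :=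
  ShadowModularity → ShadowConverse → SectorComplement → _root_.Langlands

-- `Assembly` holds: proved by `Summit.Langlands.Langlands.Theorems.holomorphicShadow_assembly_proof` (its module imports this route file, so no `_holds` link can be stated here).

-- records of items no longer active in this route (dropped / restated):
-- earlier OffEvenArtinSC (stmt-Langlands-13062, replaced 2026-08-16T03:02:36Z -> stmt-Langlands-14113): retired by None — (∀ σ : Literature.NumberTheory.GaloisRepresentations.FramedGaloisRep ℚ ℂ 2, σ.toGaloisRep.IsIrreducible → (∀ (φ : ℚ →+* ℝ) (c : Field.absoluteGaloisGroup ℚ), Literature.NumberTheory.GaloisRepresentations.IsComplexConjugation φ c → Matrix.GeneralLinearGroup.det (σ c) = 1) → ∃ (hcp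

/-! D-0027 §2.1 — DECIDING THEOREM (planner-authored via `route open/edit --closes-file`; by planner-rchoice-Langlands-HolomorphicShadow-pa-37d1e7cd-g3-0 2026-08-16T04:07:57Z):
its hypotheses are this route's items and its conclusion the sub-problem Statement (glue_lint), and it elaborates with this file. -/

@[closes "route-Langlands-HolomorphicShadow"] theorem closes (hSM : ShadowModularity) (hSC : ShadowConverse) (hC : SectorComplement) :
    _root_.Langlands := by
  refine hC ?_
  intro σ hirr N χ ε a hN hε hpar hgrowth hpin
  obtain ⟨L₀, hL₀, hNL₀, hmod⟩ := hSM σ hirr N χ ε a hN hε hpar hpin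
  exact ⟨L₀, hL₀, hNL₀, hSC N L₀ χ (1 : DirichletCharacter ℂ L₀) ε a 4 hN hNL₀ hL₀ hε hgrowth
    (fun k hk b g hg => hmod k hk L₀ (dvd_refl L₀) hL₀ 1 b g hg)⟩

end Summit.Langlands.Langlands.Theses.HolomorphicShadow
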